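import Literature.MathematicalPhysics.QuantumFieldTheory.Balaban1983to89.B4Eq48FirstOrder
import Literature.MathematicalPhysics.QuantumFieldTheory.Balaban1983to89.B4Eq49TwoBlockGreen
import Literature.MathematicalPhysics.QuantumFieldTheory.Balaban1983to89.B4Lemma22HolderBox

/-!
# `Balaban1983to89.B4Ineq410FirstOrder` — T. Bałaban, *Regularity and decay of lattice Green's functions*, Commun.
# Math. Phys. **89** (1983) 571–597 [Balaban1983RegularityDecay], §4 pp. 590–591 [PDF 20–21]: the display **(4.10),
# FIRST INEQUALITY** of the proof of Proposition 3.1′ — the first-order term (4.8) of the left side of (4.7) is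
# `O(1)ep(e)·|U(A₀(⟨x,x′⟩))φ(x′) − φ(x)|·(|φ(x)| + |φ(x′)|)` — as a kernel theorem on the actual objects (the
# two-block Neumann box `Δ(x,x′)`, the flow `e^{tq}` of (1.2) with any antisymmetric `q`, the Green's function (1.6)),
# from (4.9) (`B4Eq49TwoBlockGreen`) and «φ(x)·qφ(x) = 0 because q is an antisymmetric matrix»; with the print's own
# «gauge away A₀» step PROVED for (4.8), and the δ-split right member of (4.10)

statement-level skeleton of published theorems with citation tags; proofs where landed; nothing here is a claim about the Yang–Mills mass gap

PDF held: `paper:balaban1983-cmp89-regularity-decay` (renders `run/shared/lean/pub/pub-balaban/b2b-balaban-ref1/pages/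
1983-cmp89-regularity-decay/1983-cmp89-regularity-decay-p020-x2.png`, `…-p021-x2.png`, READ AS IMAGES — the text layer
of (4.8)–(4.10) is garbled; journal page = PDF page + 570).

CITATION HEADER (lean-in-tree rule).  lit-balaban cell (HOME `run/shared/lean/pub/lit-balaban/`), block B4 (fold
owner r01), SKELETON row **`B4.Eq4.11`** ((4.8)–(4.13)); written by the block's second reader, unit `lit-balaban-r04`
gen 12 (free-target protocol G.5-34(d), TAKING 2026-08-22T05:32Z, r01 named).  Companion of `B4Eq48FirstOrder` ((4.8) =
`firstOrder48`, the `t`-derivative at `0` of the left side of (4.7) along `A₀ + tA′`; r04 g11), `B4Eq49TwoBlockGreen`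
((4.9) = `eq49`, both lines with one scale-uniform constant; r04 g11) and r01's `B4Ineq410GaugeOut` ((4.10)'s
mechanism `φ·qφ = 0`, the δ-splitting `delta_split`, (4.11) `ineq411` with the first-order bound as the hypothesis
`hF`, the gauge-out of a constant field `lhs47_bondGauge`/`gaugeOut`).  Inputs USED BY NAME, not re-proved: the
above; `B4GaugeCovariance` (the operators (1.3)–(1.6), `b4Op_zero`/`b4Op_constBond`, the box weights `boxWt`/`blkWt`,
`scalarOp_box`); `B4Eq12ExpFlow.expFlow`; the Euclidean colour norm `B4Lemma21Region.siteNorm` with its API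
(`B4Lemma22Reduce231`, `B4Lemma22HolderBox.siteNorm_sub_le`); the box combinatorics `B4Reflection242.card_nbrs`,
`B4BoxCov237.card_filter_blk`, `boxOpR_det_isUnit`.

## THE PRINT (verbatim, p. 590 [PDF 20] – p. 591 [PDF 21]; `≦` written `≤`)

p. 590: *"We will transform the left hand side of (4.7). Using the regularity condition for A, we write A = A₀ + A′
on Δ(x,x′) with A₀ constant and A′ satisfying the bounds |A′|, |∂^η_μA′| ≤ O(1)p(e). We expand the expression on the
left hand side of (4.7) with respect to A′ using (I.3.15), (I.3.44), and we separate terms of first order in e. …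
Denoting φ^{(k)} = a_kG_k(Δ(x,x′),A₀)Q_k^*(A₀)φ, we have the following expression [(4.8), the three displayed lines —
`B4Eq48FirstOrder.firstOrder48`]. Now we have to inspect closely the proof of the Lemma II.2.4. At first let us
notice that we can "gauge away" the configuration A₀ using the same gauge transformation, and we get the expression
(4.8) with A₀ = 0 and φ(x), φ(x′) replaced by φ(x), U(A₀(⟨x,x′⟩))φ(x′) respectively. Then using II.2.75 we have
[(4.9) — `B4Eq49TwoBlockGreen.eq49`]"*

p. 591: *"and this implies the following estimate
|(the expression (4.8))| ≤ |(4a_k/(1+m²)²)[φ(x)·qφ(x)] Σ_{y=x,x′}Σ_{z∈B^k(y)} η^deηA′(Γ_{y,z})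
  − (4a_k/(1+m²))[φ(x)·qφ(x)] Σ_{y=x,x′}Σ_{z∈B^k(y)} η^deηA′(Γ_{y,z})| + O(1)ep(e)|U(A₀(⟨x,x′⟩))φ(x′) − φ(x)|(|φ(x)| + |φ(x′)|)
  ≤ δ|U(A₀(⟨x,x′⟩))φ(x′) − φ(x)|² + O(δ^{−1})e²p²(e)(|φ(x)|² + |φ(x′)|²),
  (φ(x)·qφ(x) = 0 because q is an antisymmetric matrix), for arbitrary δ > 0.   (4.10)
Thus we get (the left hand side of (4.7)) ≥ (the left hand side of (4.7) with A replaced by A₀)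
  − δ|U(A₀(⟨x,x′⟩))φ(x′) − φ(x)|² − O(δ^{−1})e²p²(e)(|φ(x)|² + |φ(x′)|²).   (4.11)"*

## WHAT IS CERTIFIED (kernel theorems; zero `sorry`, standard axioms; no `Prop`-valued statement is introduced)

* §1 (generic finite carrier) **«we can "gauge away" the configuration A₀ … and we get the expression (4.8) with
  A₀ = 0 and φ(x), φ(x′) replaced by φ(x), U(A₀(⟨x,x′⟩))φ(x′)»** for the first-order term itself:
  `firstOrder48_constBond` — `firstOrder48(A₀, A′, φ) = firstOrder48(0, A′, φ″)`, `φ″ = B4Ineq410GaugeOut.gaugeOut … x₀ φ`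
  (`φ″(x₀) = φ(x₀)`, `φ″(y) = U(A₀(Γ_{x₀→y}))φ(y)`), for every constant field, every carrier with admissible contours and
  invertible scalar operator; proof = the line `A₀ + tA′` is the gauge transform of the line `tA′`
  (`constBond_add_eq_bondGauge`), gauge covariance of the left side of (4.7) (r01 `lhs47_bondGauge`), and uniqueness of
  the derivative (`B4Eq48FirstOrder.hasDerivAt_lhs47`); `isUnit_b4Op_zero`, `isUnit_b4Op_constBond`.
* §2 norm plumbing for `siteNorm` (componentwise domination, `|qu| ≤ ‖q‖_F|u|`, orthogonal invariance).
* §3 the two-block box at `A = 0`: r01's outer weight `n^{−(d+1)/2}·1[z ∈ B^k(y)]` on the box carrier (`outWtB`), the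
  abbreviations `firstOrder48Box`/`lhs47Box` ((4.8) and the left side of (4.7) at [B4]'s box weights), the labels
  `siteX = x`, `siteX' = x′` (`sum_Y`: «Σ_{y=x,x′}»), `card_box` (`|Δ(x,x′)| = 2n^{d+1}`), `card_nbrs_box_le`, and
  **`fld_phiK0_box`**: the field `φ^{(k)}` inside (4.8) IS `n^{−(d+1)/2}·B4Eq49TwoBlockGreen.phiK` (the object of (4.9)).
* §4 the estimates: `bond_term_bound` (a summand of the first line after (4.9)), `block_term_bound` (a summand of the
  second/third lines: `|(φ^{(k)}(z) − φ(y))·qφ^{(k)}(z′)| ≤ Λ(1+3C+C²)·X·W`, the would-be leading term `c₀²S·(v·qv)`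
  VANISHING IDENTICALLY — the print's parenthesis), `firstOrder48_zero_split`, `line1_sum_bound`
  (`≤ 2(d+1)·ε₁·CΛ(1+C)·X·W`), `line23_sum_bound` (`≤ 2a_k·ε₂·Λ(1+3C+C²)·X·W`).
* §5 **`ineq410_first_zero`** — (4.10), first inequality, at `A₀` gauged away: ∃ `K = K(d, q, a₊, C₍₄.₉₎) ≥ 0` ∀ `n ≥ 1`,
  `a_k ∈ [a₋,a₊]`, `m² ∈ [0,m²₊]`, `μ`, `κ`, `emb`, `Γ`, `A′` with `n|κA′_b| ≤ ε₁` on the bonds of `Δ(x,x′)` and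
  `|κA′(Γ_{y,z})| ≤ ε₂` on its block contours, ∀ `φ″`:
  `|firstOrder48Box … 0 A′ φ″| ≤ K(ε₁ + ε₂)·|w − v|·(|v| + |w|)` (`v = φ″(x)`, `w = φ″(x′)`);
  **`hasDerivAt_lhs47Box`** ((4.8) is the derivative of the left side of (4.7) on the box, hypothesis-free at constant
  `A₀`); **`ineq410_delta_zero`** (the printed outer inequality with `O(δ⁻¹) = K²/(2δ)`, via r01's `delta_split`);
  **`ineq410_first_constBond`** (the same at the constant background `A₀` for the original `φ`, by §1 and
  `|U(A₀(⟨x,x′⟩))φ(x′)| = |φ(x′)|`); **`ineq411_box`** — r01's `B4Ineq410GaugeOut.ineq411` with its hypothesis `hF`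
  DISCHARGED on the model: (4.11) now rests only on the printed decomposition with the second-order remainder `hR`
  («Using Lemma 2.1 the remaining terms can be easily estimated by O(e²p²(e))(|φ(x)|² + |φ(x′)|²)»).

## DICTIONARY (print ↦ Lean; cf. `B4Eq48FirstOrder`, `B4Eq49TwoBlockGreen`)

`Δ(x,x′) = B^k(x) ∪ B^k(x′)`, `⟨x,x′⟩ = ⟨0, e_μ⟩` ↦ the fine box over `boxDom (twoBlk μ) = {0, e_μ}`, sites
`↥(boxDom (fun i => n * twoBlk μ i))`, `n = L^k = η^{-1}`; `e^{qeηA}` ↦ `fieldLink (expFlow q hq) κ A`, `κ = eη`;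
`|eA′_b| ≤ ε₁` ↦ `n·|κ·A′ z z′| ≤ ε₁` on nearest-neighbour pairs of the box; `|eηA′(Γ^{(k)}_{y,z})| ≤ ε₂` ↦
`|κ·lsum A′ (emb y) (Γ y z)| ≤ ε₂` for `z ∈ B^k(y)` (print: both `≤ O(1)ep(e)` from `|A′| ≤ O(1)p(e)` and `|Γ^{(k)}_{y,z}| ≤
(d+1)·n` fine steps); `|·|` on `R^N` ↦ `B4Lemma21Region.siteNorm` (Euclidean); `φ(x)`, `U(A₀(⟨x,x′⟩))φ(x′)` ↦ `v = fld φ″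
(siteX μ)`, `w = fld φ″ (siteX' μ)`; `O(1)` ↦ the explicit `K`; `O(δ^{−1})` ↦ `K²/(2δ)`; `e²p²(e)` ↦ `(ε₁ + ε₂)²`.

## HONEST SCOPE / located readings

(a) The print's two bracketed terms (coefficients `4a_k/(1+m²)²`, `4a_k/(1+m²)`) are not displayed here: they vanish
identically (r01's `B4Ineq410GaugeOut.first_order_terms_eq_zero`) and the kernel bound goes directly to the `O(1)`
member; inside `block_term_bound` the corresponding term is `c₀²·S·(v·qv) = 0` with `c₀ = a_k/(a_k+m²)` (the located
reading of `B4Eq49TwoBlockGreen`: print's `1/(1+m²)` is its value at `a_k = 1`).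
(b) `O(1)` depends on `d`, on the window `[a₋,a₊] × [0,m²₊]` (through the constant of (4.9)) and on the charge matrix
`q` (through `‖q‖_F`) — print: «γ₀′ independent of k, ⟨x,x′⟩, and A»; the constant is uniform in the scale `n`, the
direction `μ`, the coupling, the embedding/contours and the fields, as printed.
(c) The second inequality needed for (4.11) — the second-order remainder «O(e²p²(e))(|φ(x)|² + |φ(x′)|²)» — is NOT
estimated here (hypothesis `hR` of `ineq411_box`, as in r01's `ineq411`); the print imports it from [2] Lemma 2.4 /
(II.2.75) and this paper's Lemma 2.1.
(d) The first line of (4.8) is taken with the bond measure `η^d` of (1.3) (r01's normalisation; located reading (b) of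
`B4Eq48FirstOrder`); (4.10)'s bound is insensitive to it.
(e) The transporter in `ineq410_first_constBond` runs from the block site `emb x` to `emb x′` (for the constant field
every contour gives the same `U(κ⟨A₀, emb x′ − emb x⟩)`, r01's `transport_constBond`); with block base points this is
the printed `U(A₀(⟨x,x′⟩)) = e^{qeA₀,μ}`.
No existing module is modified; three `import`s.
-/

namespace Literature.MathematicalPhysics.QuantumFieldTheory.Balaban1983to89.B4Ineq410FirstOrder

open scoped Kronecker
open Finset Matrix
open Literature.MathematicalPhysics.QuantumFieldTheory.Balaban1983to89
open Literature.MathematicalPhysics.QuantumFieldTheory.Balaban1983to89.B4GaugeCovariance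
open Literature.MathematicalPhysics.QuantumFieldTheory.Balaban1983to89.B4Lower18Regular (lsum transport_fieldLink)
open Literature.MathematicalPhysics.QuantumFieldTheory.Balaban1983to89.B4Ineq410GaugeOut
  (qgq lhs47 lhs47_bondGauge gaugeOut gaugeOutMat gaugeOut_fld gaugeOut_fld_base delta_split
    dotProduct_mulVec_self_eq_zero)
open Literature.MathematicalPhysics.QuantumFieldTheory.Balaban1983to89.B4Eq12ExpFlow (expFlow expFlow_U)
open Literature.MathematicalPhysics.QuantumFieldTheory.Balaban1983to89.B4Eq48FirstOrder
  (phiK0 dAvg firstOrder48 hasDerivAt_lhs47)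
open Literature.MathematicalPhysics.QuantumFieldTheory.Balaban1983to89.B4Eq49TwoBlockGreen
  (twoBlk one_le_twoBlk mem_boxDom_twoBlk zero_mem_boxDom_twoBlk single_mem_boxDom_twoBlk blk_twoBlk phiK eq49
    phiK_eq_b4Green)
open Literature.MathematicalPhysics.QuantumFieldTheory.Balaban1983to89.B4Reflection242
  (boxDom nbrs mem_nbrs card_nbrs nbrs_comm blk blk_mem_boxDom mem_boxDom)
open Literature.MathematicalPhysics.QuantumFieldTheory.Balaban1983to89.B4BoxCov237 (boxOpR card_filter_blk boxOpR_det_isUnit)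
open Literature.MathematicalPhysics.QuantumFieldTheory.Balaban1983to89.B4Lemma21Region (siteNorm)
open Literature.MathematicalPhysics.QuantumFieldTheory.Balaban1983to89.B4Lemma22Reduce231
  (siteNorm_nonneg siteNorm_zero siteNorm_sq abs_dot_le siteNorm_add_le siteNorm_smul)
open Literature.MathematicalPhysics.QuantumFieldTheory.Balaban1983to89.B4Lemma22HolderBox (siteNorm_sub_le)

noncomputable section

/-! ## §1. «We can "gauge away" the configuration A₀ using the same gauge transformation, and we get the
expression (4.8) with A₀ = 0 and φ(x), φ(x′) replaced by φ(x), U(A₀(⟨x,x′⟩))φ(x′) respectively» (p. 590) —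
PROVED for the first-order term (4.8) itself, on the generic carrier -/

section GaugeAway

variable {X Y ι : Type*} [Fintype X] [Fintype Y] [Fintype ι] [DecidableEq X] [DecidableEq Y] [DecidableEq ι]
variable {d : ℕ}

omit [Fintype X] [DecidableEq X] in
/-- the line `A₀ + B` through a CONSTANT field is the gauge transform of the line `B` through zero by (any shift
of) the linear gauge function `λ = −⟨A₀,·⟩`: `A₀ + B = B^{λ − λ₀}` — «A = A₀ + A′ on Δ(x,x′) with A₀ constant»,
«we can "gauge away" the configuration A₀». [cite: Balaban1983RegularityDecay, p.590] -/
theorem constBond_add_eq_bondGauge (A₀ : Fin (d + 1) → ℝ) (pos : X → (Fin (d + 1) → ℤ)) (lam0 : ℝ)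
    (B : X → X → ℝ) :
    constBond A₀ pos + B = bondGauge (fun u => linGauge A₀ pos u - lam0) B := by
  funext u v
  simp only [Pi.add_apply, bondGauge, constBond, linGauge, mul_sub, Finset.sum_sub_distrib]
  ring

omit [DecidableEq Y] in
/-- at `A = 0` [B4]'s operator (1.6) `H(0) = H_scalar ⊗ 1_N` is invertible as soon as its scalar part is.
[cite: Balaban1983RegularityDecay, (1.6) p.572 with p.582 «G_k(□,0) = G_k(□)1»] -/
theorem isUnit_b4Op_zero (F : OrthFlow ι) (κ : ℝ) (c : X → X → ℝ) (m2 a : ℝ) (q : Y → X → ℝ)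
    (emb : Y → X) (Γ : Y → X → List X) (hS : IsUnit (scalarOp c m2 a q).det) :
    IsUnit (b4Op F κ c m2 a q emb Γ (0 : X → X → ℝ)) := by
  rw [b4Op_zero, Matrix.isUnit_iff_isUnit_det, Matrix.det_kronecker, Matrix.det_one, one_pow, mul_one]
  exact hS.pow _

/-- at a CONSTANT field `A₀` [B4]'s operator (1.6) is invertible as soon as its scalar part is
(`H(A₀) = 𝒢(H_scalar ⊗ 1_N)𝒢ᵀ`, `B4GaugeCovariance.b4Op_constBond`). [cite: Balaban1983RegularityDecay, (1.6) p.572 with p.581 «equivalent to the case of configuration A₀ = 0»] -/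
theorem isUnit_b4Op_constBond (F : OrthFlow ι) (κ : ℝ) (c : X → X → ℝ) (m2 a : ℝ) {q : Y → X → ℝ}
    {emb : Y → X} {Γ : Y → X → List X} (hend : ∀ y x, q y x ≠ 0 → pathEnd (emb y) (Γ y x) = x)
    (hS : IsUnit (scalarOp c m2 a q).det) (A₀ : Fin (d + 1) → ℝ) (pos : X → (Fin (d + 1) → ℤ)) :
    IsUnit (b4Op F κ c m2 a q emb Γ (constBond A₀ pos)) := by
  rw [b4Op_constBond F κ c m2 a hend A₀ pos]
  have hg : IsGauge fun u : X => F.U (κ * linGauge A₀ pos u) := F.isGauge _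
  have h0 : IsUnit (scalarOp c m2 a q ⊗ₖ (1 : Matrix ι ι ℝ)) := by
    rw [Matrix.isUnit_iff_isUnit_det, Matrix.det_kronecker, Matrix.det_one, one_pow, mul_one]
    exact hS.pow _
  have h1 : IsUnit (blockDiag fun u : X => F.U (κ * linGauge A₀ pos u)) :=
    (Matrix.isUnit_iff_isUnit_det _).2 (Matrix.isUnit_det_of_right_inverse (blockDiag_mul_transpose_self hg))
  have h2 : IsUnit (blockDiag fun u : X => F.U (κ * linGauge A₀ pos u))ᵀ :=
    (Matrix.isUnit_iff_isUnit_det _).2 (Matrix.isUnit_det_of_left_inverse (blockDiag_mul_transpose_self hg))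
  exact (h1.mul h0).mul h2

variable (q : Matrix ι ι ℝ) (hq : qᵀ = -q) (κ : ℝ)

/-- **«WE CAN "GAUGE AWAY" THE CONFIGURATION A₀ … AND WE GET THE EXPRESSION (4.8) WITH A₀ = 0 AND φ(x), φ(x′)
REPLACED BY φ(x), U(A₀(⟨x,x′⟩))φ(x′) RESPECTIVELY»** (p. 590), for the first-order term (4.8) of the left side
of (4.7) (`B4Eq48FirstOrder.firstOrder48`, the flow `e^{tq}` of (1.2) with any antisymmetric `q`): on every finite
carrier, for every constant field `A₀` (sites at integer positions `pos`), every direction `A′`, every block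
weights with admissible contours and every unit-lattice field `φ = Ψ`,
`firstOrder48(A₀, A′, φ) = firstOrder48(0, A′, φ″)` with `φ″ = B4Ineq410GaugeOut.gaugeOut … x₀ Ψ` the field gauged
by the normalised linear gauge (`φ″(x₀) = φ(x₀)`, `φ″(y) = U(A₀(Γ_{x₀→y}))φ(y)`, r01's `gaugeOut_fld`).  Proof: the
whole line `A₀ + tA′` is the gauge transform of the line `tA′` (`constBond_add_eq_bondGauge`), the left side of
(4.7) is gauge covariant (`B4Ineq410GaugeOut.lhs47_bondGauge`), and (4.8) is its `t`-derivative at `0`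
(`B4Eq48FirstOrder.hasDerivAt_lhs47`, uniqueness of derivatives). [cite: Balaban1983RegularityDecay, p.590] -/
theorem firstOrder48_constBond (c : X → X → ℝ) (m2 a : ℝ) {qin qout : Y → X → ℝ} {emb : Y → X}
    {Γ : Y → X → List X} (hend : ∀ y x, qin y x ≠ 0 → pathEnd (emb y) (Γ y x) = x)
    (hend' : ∀ y x, qout y x ≠ 0 → pathEnd (emb y) (Γ y x) = x)
    (hS : IsUnit (scalarOp c m2 a qin).det) (ak : ℝ) (A₀ : Fin (d + 1) → ℝ) (pos : X → (Fin (d + 1) → ℤ))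
    (x₀ : Y) (A' : X → X → ℝ) (Ψ : Y × ι → ℝ) :
    firstOrder48 q hq κ c m2 a qin qout emb Γ ak (constBond A₀ pos) A' Ψ
      = firstOrder48 q hq κ c m2 a qin qout emb Γ ak 0 A' (gaugeOut (expFlow q hq) κ emb A₀ pos x₀ Ψ) := by
  have h1 := hasDerivAt_lhs47 q hq κ c m2 a qin qout emb Γ ak (constBond A₀ pos) A' Ψ
    (isUnit_b4Op_constBond (expFlow q hq) κ c m2 a hend hS A₀ pos)
  have h2 := hasDerivAt_lhs47 q hq κ c m2 a qin qout emb Γ ak 0 A' (gaugeOut (expFlow q hq) κ emb A₀ pos x₀ Ψ)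
    (isUnit_b4Op_zero (expFlow q hq) κ c m2 a qin emb Γ hS)
  have hfun : (fun t : ℝ => lhs47 (expFlow q hq) κ c m2 a qin qout emb Γ ak (constBond A₀ pos + t • A') Ψ)
      = fun t : ℝ => lhs47 (expFlow q hq) κ c m2 a qin qout emb Γ ak ((0 : X → X → ℝ) + t • A')
          (gaugeOut (expFlow q hq) κ emb A₀ pos x₀ Ψ) := by
    funext t
    rw [constBond_add_eq_bondGauge A₀ pos (linGauge A₀ pos (emb x₀)) (t • A'),
      lhs47_bondGauge (expFlow q hq) κ c m2 a hend hend', zero_add]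
    rfl
  rw [hfun] at h1
  exact h1.unique h2

end GaugeAway

/-! ## §2. Euclidean colour norms: the inequalities used below -/

section Norms

variable {ι : Type} [Fintype ι]

/-- componentwise domination gives domination of the Euclidean colour norms (the `O(·)` of (4.9) is certified
colour by colour in `B4Eq49TwoBlockGreen.eq49`; (4.10) uses it in norm). [cite: Balaban1983RegularityDecay, (4.9)–(4.10) pp.590–591] -/
theorem siteNorm_le_of_abs_le {C : ℝ} (hC : 0 ≤ C) {u t : ι → ℝ} (h : ∀ i, |u i| ≤ C * |t i|) :
    siteNorm u ≤ C * siteNorm t := by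
  have h2 : u ⬝ᵥ u ≤ C ^ 2 * (t ⬝ᵥ t) := by
    simp only [dotProduct, Finset.mul_sum]
    refine Finset.sum_le_sum fun i _ => ?_
    have hi := h i
    have h0 : 0 ≤ |u i| := abs_nonneg _
    calc u i * u i = |u i| ^ 2 := by rw [← sq, sq_abs]
      _ ≤ (C * |t i|) ^ 2 := pow_le_pow_left₀ h0 hi 2
      _ = C ^ 2 * (t i * t i) := by rw [mul_pow, sq_abs]; ring
  have h3 : siteNorm u ^ 2 ≤ (C * siteNorm t) ^ 2 := by
    rw [siteNorm_sq, mul_pow, siteNorm_sq]; exact h2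
  exact (pow_le_pow_iff_left₀ (siteNorm_nonneg u) (mul_nonneg hC (siteNorm_nonneg t)) two_ne_zero).1 h3

/-- `|qu| ≤ ‖q‖_F·|u|` with the Frobenius constant `‖q‖_F = (Σ_{ij} q_{ij}²)^{1/2}` (the `O(1)` of (4.10) depends on
the charge matrix `q` of (1.2) through this constant). [cite: Balaban1983RegularityDecay, (1.2) p.572, (4.10) p.591] -/
theorem siteNorm_mulVec_le (q : Matrix ι ι ℝ) (u : ι → ℝ) :
    siteNorm (q *ᵥ u) ≤ Real.sqrt (∑ i, ∑ j, q i j ^ 2) * siteNorm u := by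
  have h1 : (q *ᵥ u) ⬝ᵥ (q *ᵥ u) ≤ (∑ i, ∑ j, q i j ^ 2) * (u ⬝ᵥ u) := by
    have hu : u ⬝ᵥ u = ∑ j, u j ^ 2 := by simp [dotProduct, sq]
    rw [hu, Finset.sum_mul]
    unfold dotProduct
    refine Finset.sum_le_sum fun i _ => ?_
    rw [← sq, Matrix.mulVec, dotProduct]
    exact Finset.sum_mul_sq_le_sq_mul_sq Finset.univ (fun j => q i j) u
  have h2 : siteNorm (q *ᵥ u) ^ 2 ≤ (Real.sqrt (∑ i, ∑ j, q i j ^ 2) * siteNorm u) ^ 2 := by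
    rw [siteNorm_sq, mul_pow, Real.sq_sqrt (by positivity), siteNorm_sq]; exact h1
  have h0 : 0 ≤ Real.sqrt (∑ i, ∑ j, q i j ^ 2) * siteNorm u := mul_nonneg (Real.sqrt_nonneg _) (siteNorm_nonneg u)
  nlinarith [siteNorm_nonneg (q *ᵥ u), h2, h0]

/-- orthogonal matrices preserve the colour norm: `|Ow| = |w|` (so `|U(A₀(⟨x,x′⟩))φ(x′)| = |φ(x′)|` in (4.10)).
[cite: Balaban1983RegularityDecay, (4.10) p.591] -/
theorem siteNorm_mulVec_of_orth [DecidableEq ι] {O : Matrix ι ι ℝ} (hO : Oᵀ * O = 1) (w : ι → ℝ) :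
    siteNorm (O *ᵥ w) = siteNorm w := by
  unfold siteNorm
  rw [Matrix.dotProduct_mulVec, ← Matrix.mulVec_transpose, Matrix.mulVec_mulVec, hO, Matrix.one_mulVec]

/-- `|u − t| = |t − u|`. [cite: Balaban1983RegularityDecay, (4.10) p.591] -/
theorem siteNorm_sub_comm (u t : ι → ℝ) : siteNorm (u - t) = siteNorm (t - u) := by
  rw [← neg_sub, show -(t - u) = (-1 : ℝ) • (t - u) by simp, siteNorm_smul, abs_neg, abs_one, one_mul]

end Norms

/-! ## §3. The two-block Neumann box `Δ(x,x′)` at `A = 0`: r01's normalisation of (4.7) on the box carrier,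
the field `φ^{(k)}` of (4.8) IS `n^{−(d+1)/2}·(B4Eq49TwoBlockGreen.phiK)`, and the counting lemmas -/

section ZeroField

variable {X Y ι : Type*} [Fintype X] [Fintype Y] [Fintype ι] [DecidableEq X] [DecidableEq Y] [DecidableEq ι]

omit [Fintype X] [Fintype Y] [DecidableEq X] [DecidableEq Y] in
/-- at `A = 0` every transporter `U(A(Γ_{y,x}))` is `1`. [cite: Balaban1983RegularityDecay, (1.4) p.572, p.590 «with A₀ = 0»] -/
theorem contourTrans_zero (F : OrthFlow ι) (κ : ℝ) (emb : Y → X) (Γ : Y → X → List X) :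
    contourTrans (fieldLink F κ (0 : X → X → ℝ)) emb Γ = fun _ _ => (1 : Matrix ι ι ℝ) := by
  funext y x
  rw [fieldLink_zero]
  exact transport_one _ _

omit [Fintype X] [Fintype Y] [Fintype ι] [DecidableEq X] [DecidableEq Y] [DecidableEq ι] in
/-- the averaging operator (1.4) is linear in its block weights: `Q[s·q] = s·Q[q]` (the outer weight of (4.7) is
`n^{−(d+1)/2}` times the indicator weight). [cite: Balaban1983RegularityDecay, (1.4) p.572, (4.7) p.590] -/
theorem avgOp_const_mul (s : ℝ) (qw : Y → X → ℝ) (T : Y → X → Matrix ι ι ℝ) :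
    avgOp (fun y x => s * qw y x) T = s • avgOp qw T := by
  unfold avgOp
  rw [← blockOp_smul]
  congr 1
  funext y x
  simp only [Pi.smul_apply, smul_smul]

variable (q : Matrix ι ι ℝ) (hq : qᵀ = -q) (κ : ℝ)

omit [Fintype Y] [DecidableEq X] [DecidableEq Y] in
/-- at `A = 0` the inner sum of the second and third lines of (4.8) is `Σ_x q(y,x)κA′(Γ_{y,x})·qφ(x)`.
[cite: Balaban1983RegularityDecay, (4.8) p.590 «with A₀ = 0»] -/
theorem dAvg_zero (qw : Y → X → ℝ) (emb : Y → X) (Γ : Y → X → List X) (A' : X → X → ℝ) (φ : X × ι → ℝ)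
    (y : Y) :
    dAvg q hq κ qw emb Γ 0 A' φ y = ∑ x, (qw y x * (κ * lsum A' (emb y) (Γ y x))) • (q *ᵥ fld φ x) := by
  unfold dAvg
  refine Finset.sum_congr rfl fun x _ => ?_
  rw [contourTrans_zero, Matrix.one_mulVec]

end ZeroField

section Box

variable {d : ℕ} {ι : Type} [Fintype ι] [DecidableEq ι]

/-- THE OUTER WEIGHT of the sandwich `Q_kG_kQ_k^*` of (4.7) on the box carrier (the twin of r01's
`B4Ineq412ConstField.outWt`): `q′(y,x) = n^{−(d+1)/2}·1[x ∈ B^k(y)]`, which makes `B4Ineq410GaugeOut.lhs47` the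
printed left side of (4.7) and `B4Eq48FirstOrder.firstOrder48` the printed (4.8).
[cite: Balaban1983RegularityDecay, (1.4) p.572, (4.7) p.590, dictionary] -/
def outWtB (n : ℕ) (μ : Fin (d + 1)) : ↥(boxDom (twoBlk μ)) → ↥(boxDom (fun i => n * twoBlk μ i)) → ℝ :=
  fun y x => (Real.sqrt ((n : ℝ) ^ (d + 1)))⁻¹ * blkWt n (twoBlk μ) (fun i => n * twoBlk μ i) y x

/-- **THE FIRST-ORDER TERM (4.8) ON THE TWO-BLOCK REGION `Δ(x,x′) = B^k(x) ∪ B^k(x′)`** of the unit bond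
`⟨x,x′⟩ = ⟨0,e_μ⟩` (Neumann box of unit trace `twoBlk μ`, scale `n = η^{-1}`), with [B4]'s weights (`boxWt`: `n²/2`
per oriented bond; `blkWt` with coefficient `a_k·n^{−(d+1)}` inside `G_k`; outer weight `outWtB`), the flow
`e^{tq}` of (1.2), background `A₀`, direction `A′`, unit-lattice field `φ = Ψ`:
`B4Eq48FirstOrder.firstOrder48` at these data. [cite: Balaban1983RegularityDecay, (4.8) p.590] -/
def firstOrder48Box (q : Matrix ι ι ℝ) (hq : qᵀ = -q) (κ : ℝ) (n : ℕ) (a m2 : ℝ) (μ : Fin (d + 1))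
    (emb : ↥(boxDom (twoBlk μ)) → ↥(boxDom (fun i => n * twoBlk μ i)))
    (Γ : ↥(boxDom (twoBlk μ)) → ↥(boxDom (fun i => n * twoBlk μ i)) → List ↥(boxDom (fun i => n * twoBlk μ i)))
    (A₀ A' : ↥(boxDom (fun i => n * twoBlk μ i)) → ↥(boxDom (fun i => n * twoBlk μ i)) → ℝ)
    (Ψ : ↥(boxDom (twoBlk μ)) × ι → ℝ) : ℝ :=
  firstOrder48 q hq κ (boxWt n (fun i => n * twoBlk μ i)) m2 (a * ((n : ℝ) ^ (d + 1))⁻¹)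
    (blkWt n (twoBlk μ) (fun i => n * twoBlk μ i)) (outWtB n μ) emb Γ a A₀ A' Ψ

/-- **THE LEFT SIDE OF (4.7) ON THE TWO-BLOCK REGION** in r01's normalisation (`B4Ineq410GaugeOut.lhs47` at the box
data): `a_k|φ(x)|² + a_k|φ(x′)|² − a_k²⟨φ, Q_k(A)G_k(Δ(x,x′),A)Q_k^*(A)φ⟩`. [cite: Balaban1983RegularityDecay, (4.7) p.590] -/
def lhs47Box (F : OrthFlow ι) (κ : ℝ) (n : ℕ) (a m2 : ℝ) (μ : Fin (d + 1))
    (emb : ↥(boxDom (twoBlk μ)) → ↥(boxDom (fun i => n * twoBlk μ i)))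
    (Γ : ↥(boxDom (twoBlk μ)) → ↥(boxDom (fun i => n * twoBlk μ i)) → List ↥(boxDom (fun i => n * twoBlk μ i)))
    (A : ↥(boxDom (fun i => n * twoBlk μ i)) → ↥(boxDom (fun i => n * twoBlk μ i)) → ℝ)
    (Ψ : ↥(boxDom (twoBlk μ)) × ι → ℝ) : ℝ :=
  lhs47 F κ (boxWt n (fun i => n * twoBlk μ i)) m2 (a * ((n : ℝ) ^ (d + 1))⁻¹)
    (blkWt n (twoBlk μ) (fun i => n * twoBlk μ i)) (outWtB n μ) emb Γ a A Ψ

/-- the label `x = 0` of the two-block box. [cite: Balaban1983RegularityDecay, p.590 «Δ(x,x′) = B^k(x) ∪ B^k(x′)», dictionary] -/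
def siteX (μ : Fin (d + 1)) : ↥(boxDom (twoBlk μ)) := ⟨0, zero_mem_boxDom_twoBlk μ⟩

/-- the label `x′ = e_μ` of the two-block box. [cite: Balaban1983RegularityDecay, p.590 «Δ(x,x′) = B^k(x) ∪ B^k(x′)», dictionary] -/
def siteX' (μ : Fin (d + 1)) : ↥(boxDom (twoBlk μ)) := ⟨Pi.single μ 1, single_mem_boxDom_twoBlk μ⟩

omit [Fintype ι] [DecidableEq ι] in
/-- every label of the two-block box is `x` or `x′`. [cite: Balaban1983RegularityDecay, p.590 «Δ(x,x′)», dictionary] -/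
theorem eq_siteX_or (μ : Fin (d + 1)) (y : ↥(boxDom (twoBlk μ))) : y = siteX μ ∨ y = siteX' μ := by
  rcases mem_boxDom_twoBlk.1 y.2 with h | h
  · exact Or.inl (Subtype.ext h)
  · exact Or.inr (Subtype.ext h)

omit [Fintype ι] [DecidableEq ι] in
/-- `x ≠ x′`. [cite: Balaban1983RegularityDecay, p.590 «Δ(x,x′)», dictionary] -/
theorem siteX_ne_siteX' (μ : Fin (d + 1)) : siteX μ ≠ siteX' (d := d) μ := by
  intro h
  have h1 := congrFun (congrArg Subtype.val h) μ
  simp [siteX, siteX'] at h1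

omit [Fintype ι] [DecidableEq ι] in
/-- the two-block box has exactly the two labels `x`, `x′`. [cite: Balaban1983RegularityDecay, p.590 «Δ(x,x′)», dictionary] -/
theorem univ_eq_pair (μ : Fin (d + 1)) : (Finset.univ : Finset ↥(boxDom (twoBlk μ))) = {siteX μ, siteX' μ} := by
  ext y
  simp only [Finset.mem_univ, Finset.mem_insert, Finset.mem_singleton, true_iff]
  exact eq_siteX_or μ y

omit [Fintype ι] [DecidableEq ι] in
/-- sums over the labels of `Δ(x,x′)` have two terms. [cite: Balaban1983RegularityDecay, (4.8) p.590 «Σ_{y=x,x′}»] -/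
theorem sum_Y (μ : Fin (d + 1)) (f : ↥(boxDom (twoBlk μ)) → ℝ) : ∑ y, f y = f (siteX μ) + f (siteX' μ) := by
  rw [univ_eq_pair, Finset.sum_pair (siteX_ne_siteX' μ)]

omit [Fintype ι] [DecidableEq ι] in
/-- each block of `Δ(x,x′)` has `n^{d+1}` points: `Σ_x 1[x ∈ B^k(y)] = n^{d+1}`. [cite: Balaban1983RegularityDecay, (1.1) p.572, dictionary] -/
theorem sum_blkWt_box {n : ℕ} (hn : 1 ≤ n) (μ : Fin (d + 1)) (y : ↥(boxDom (twoBlk μ))) :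
    ∑ x, blkWt n (twoBlk μ) (fun i => n * twoBlk μ i) y x = (n : ℝ) ^ (d + 1) := by
  unfold blkWt
  rw [Finset.sum_boole]
  have h := card_filter_blk hn (twoBlk μ) y
  exact_mod_cast h

omit [Fintype ι] [DecidableEq ι] in
/-- `Δ(x,x′)` has `2n^{d+1}` points. [cite: Balaban1983RegularityDecay, p.590 «Δ(x,x′) = B^k(x) ∪ B^k(x′)», dictionary] -/
theorem card_box {n : ℕ} (hn : 1 ≤ n) (μ : Fin (d + 1)) :
    (Fintype.card ↥(boxDom (fun i => n * twoBlk μ i)) : ℝ) = 2 * (n : ℝ) ^ (d + 1) := by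
  have h1 : ∀ x : ↥(boxDom (fun i => n * twoBlk μ i)),
      ∑ y : ↥(boxDom (twoBlk μ)), blkWt n (twoBlk μ) (fun i => n * twoBlk μ i) y x = 1 := by
    intro x
    unfold blkWt
    rw [Finset.sum_coe_sort (s := boxDom (twoBlk μ)) (f := fun w => if blk n x.1 = w then (1 : ℝ) else 0),
      Finset.sum_ite_eq, if_pos (blk_mem_boxDom hn x.2)]
  have h : (Fintype.card ↥(boxDom (fun i => n * twoBlk μ i)) : ℝ)
      = ∑ x : ↥(boxDom (fun i => n * twoBlk μ i)), ∑ y : ↥(boxDom (twoBlk μ)),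
          blkWt n (twoBlk μ) (fun i => n * twoBlk μ i) y x := by
    rw [← Finset.card_univ, Finset.card_eq_sum_ones, Nat.cast_sum]
    simp only [Nat.cast_one, h1]
  rw [h, Finset.sum_comm, sum_Y, sum_blkWt_box hn, sum_blkWt_box hn]
  ring

omit [Fintype ι] [DecidableEq ι] in
/-- a point of `Δ(x,x′)` has at most `2(d+1)` nearest neighbours in `Δ(x,x′)`. [cite: Balaban1983RegularityDecay, (1.3) p.572, dictionary] -/
theorem card_nbrs_box_le {n : ℕ} (μ : Fin (d + 1)) (x : ↥(boxDom (fun i => n * twoBlk μ i))) :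
    ((Finset.univ.filter fun y : ↥(boxDom (fun i => n * twoBlk μ i)) => y.1 ∈ nbrs x.1).card : ℝ)
      ≤ 2 * ((d : ℝ) + 1) := by
  have h : (Finset.univ.filter fun y : ↥(boxDom (fun i => n * twoBlk μ i)) => y.1 ∈ nbrs x.1).card
      ≤ (nbrs x.1).card :=
    Finset.card_le_card_of_injOn Subtype.val (fun y hy => (Finset.mem_filter.1 hy).2)
      (Subtype.val_injective.injOn)
  rw [card_nbrs] at h
  exact_mod_cast h

variable (q : Matrix ι ι ℝ) (hq : qᵀ = -q) (κ : ℝ)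

/-- **AT `A₀ = 0` THE FIELD `φ^{(k)}` OF (4.8) IS `n^{−(d+1)/2}·(a_kG_k(Δ(x,x′),0)Q_k^*φ″)`** with the latter =
`B4Eq49TwoBlockGreen.phiK n a_k m² μ (φ″(x)) (φ″(x′))`, the object estimated in (4.9) (r01's outer weight carries
the factor `n^{−(d+1)/2}`; dictionary `B4Eq49TwoBlockGreen.phiK_eq_b4Green`). [cite: Balaban1983RegularityDecay, (4.8)–(4.9) p.590] -/
theorem fld_phiK0_box {n : ℕ} (hn : 1 ≤ n) {a m2 : ℝ} (ha : 0 < a) (hm : 0 ≤ m2) (μ : Fin (d + 1))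
    (emb : ↥(boxDom (twoBlk μ)) → ↥(boxDom (fun i => n * twoBlk μ i)))
    (Γ : ↥(boxDom (twoBlk μ)) → ↥(boxDom (fun i => n * twoBlk μ i)) → List ↥(boxDom (fun i => n * twoBlk μ i)))
    (Ψ : ↥(boxDom (twoBlk μ)) × ι → ℝ) (z : ↥(boxDom (fun i => n * twoBlk μ i))) :
    fld (phiK0 q hq κ (boxWt n (fun i => n * twoBlk μ i)) m2 (a * ((n : ℝ) ^ (d + 1))⁻¹)
        (blkWt n (twoBlk μ) (fun i => n * twoBlk μ i)) (outWtB n μ) emb Γ a 0 Ψ) z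
      = (Real.sqrt ((n : ℝ) ^ (d + 1)))⁻¹ •
          fun i => phiK n a m2 μ (fld Ψ (siteX μ)) (fld Ψ (siteX' μ)) z i := by
  unfold phiK0 outWtB
  rw [avgOp_const_mul, Matrix.transpose_smul, Matrix.smul_mulVec, Matrix.mulVec_smul, smul_comm]
  funext i
  simp only [fld, Pi.smul_apply, smul_eq_mul]
  congr 1
  exact phiK_eq_b4Green (expFlow q hq) κ hn ha hm μ emb Γ Ψ z i

end Box

/-! ## §4. The estimates: «and this implies the following estimate |(the expression (4.8))| ≤ … +
O(1)ep(e)|U(A₀(⟨x,x′⟩))φ(x′) − φ(x)|(|φ(x)| + |φ(x′)|) … (φ(x)·qφ(x) = 0 because q is an antisymmetric matrix)» -/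

section Pointwise

variable {ι : Type} [Fintype ι]

/-- **THE SUMMAND OF THE FIRST LINE OF (4.8) AFTER (4.9)**: with `n|φ^{(k)}(z′) − φ^{(k)}(z)| ≤ C·X` (second
line of (4.9) on the bond `⟨z,z′⟩`, `X = |U(A₀(⟨x,x′⟩))φ(x′) − φ(x)|`) and `|φ^{(k)}(z)| ≤ (1 + C)·W` (first line,
`W = |φ(x)| + |φ(x′)|`): `n·|(φ^{(k)}(z′) − φ^{(k)}(z))·qφ^{(k)}(z)| ≤ CΛ(1+C)·X·W`, `Λ` a bound for `q`.
[cite: Balaban1983RegularityDecay, (4.9)–(4.10) pp.590–591] -/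
theorem bond_term_bound {q : Matrix ι ι ℝ} {Λ : ℝ} (hΛ : 0 ≤ Λ) (hqΛ : ∀ t, siteNorm (q *ᵥ t) ≤ Λ * siteNorm t)
    {n C Xr Wr : ℝ} (hn : 0 ≤ n) (hC : 0 ≤ C) (hX : 0 ≤ Xr) {φ φ' : ι → ℝ}
    (h1 : n * siteNorm (φ' - φ) ≤ C * Xr) (h2 : siteNorm φ ≤ (1 + C) * Wr) :
    n * |(φ' - φ) ⬝ᵥ (q *ᵥ φ)| ≤ C * Λ * (1 + C) * Xr * Wr := by
  have hcs := abs_dot_le (φ' - φ) (q *ᵥ φ)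
  have hq1 := hqΛ φ
  have hW : 0 ≤ Wr := by
    have := siteNorm_nonneg φ
    nlinarith
  calc n * |(φ' - φ) ⬝ᵥ (q *ᵥ φ)| ≤ n * (siteNorm (φ' - φ) * siteNorm (q *ᵥ φ)) :=
        mul_le_mul_of_nonneg_left hcs hn
    _ = (n * siteNorm (φ' - φ)) * siteNorm (q *ᵥ φ) := by ring
    _ ≤ (C * Xr) * (Λ * ((1 + C) * Wr)) := by
        refine mul_le_mul h1 (hq1.trans (mul_le_mul_of_nonneg_left h2 hΛ)) (siteNorm_nonneg _)
          (mul_nonneg hC hX)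
    _ = C * Λ * (1 + C) * Xr * Wr := by ring

/-- **THE SUMMAND OF THE SECOND AND THIRD LINES OF (4.8) AFTER (4.9), AND «φ(x)·qφ(x) = 0 BECAUSE q IS AN
ANTISYMMETRIC MATRIX»**: for `φ = φ^{(k)}(z)`, `φ′ = φ^{(k)}(z′)` within `C·X` of `c₀φ(x)` (first line of (4.9),
`0 ≤ c₀ ≤ 1`, `X = |w − v|`, `v = φ(x)`, `w = U(A₀(⟨x,x′⟩))φ(x′)`) and `u ∈ {v, w}` (the value `φ(y)`, `y = x, x′`):
`|(φ − u)·qφ′| ≤ Λ(1 + 3C + C²)·X·(|v| + |w|)` — the would-be leading term `c₀²·S·(v·qv)` (print's two bracketed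
terms of (4.10)) vanishes identically. [cite: Balaban1983RegularityDecay, (4.10) p.591] -/
theorem block_term_bound {q : Matrix ι ι ℝ} (hq : qᵀ = -q) {Λ : ℝ} (hΛ : 0 ≤ Λ)
    (hqΛ : ∀ t, siteNorm (q *ᵥ t) ≤ Λ * siteNorm t) {C c₀ : ℝ} (hC : 0 ≤ C) (hc₀ : 0 ≤ c₀) (hc₁ : c₀ ≤ 1)
    (v w u φ φ' : ι → ℝ) (hu : u = v ∨ u = w) (hφ : siteNorm (φ - c₀ • v) ≤ C * siteNorm (w - v))
    (hφ' : siteNorm (φ' - c₀ • v) ≤ C * siteNorm (w - v)) :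
    |(φ - u) ⬝ᵥ (q *ᵥ φ')| ≤ Λ * (1 + 3 * C + C ^ 2) * siteNorm (w - v) * (siteNorm v + siteNorm w) := by
  set R := φ - c₀ • v with hR
  set R' := φ' - c₀ • v with hR'
  set Xr := siteNorm (w - v) with hXr
  have h0 : v ⬝ᵥ (q *ᵥ v) = 0 := dotProduct_mulVec_self_eq_zero hq v
  -- the algebra: expand in `φ′ = c₀v + R′`, `φ = c₀v + R`, kill `v·qv`
  have hid : (φ - u) ⬝ᵥ (q *ᵥ φ') = c₀ * (R ⬝ᵥ (q *ᵥ v) - (u - v) ⬝ᵥ (q *ᵥ v)) + (φ - u) ⬝ᵥ (q *ᵥ R') := by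
    have e1 : φ' = c₀ • v + R' := by rw [hR']; abel
    have e2 : φ = c₀ • v + R := by rw [hR]; abel
    conv_lhs => rw [e1, e2]
    conv_rhs => rw [e2]
    simp only [Matrix.mulVec_add, Matrix.mulVec_smul, dotProduct_add, dotProduct_smul, add_dotProduct,
      sub_dotProduct, smul_dotProduct, smul_eq_mul, h0]
    ring
  -- the norms
  have hv0 := siteNorm_nonneg v
  have hw0 := siteNorm_nonneg w
  have hX0 : 0 ≤ Xr := siteNorm_nonneg _
  have hXW : Xr ≤ siteNorm v + siteNorm w := by
    rw [hXr, siteNorm_sub_comm]; exact siteNorm_sub_le v w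
  have huv : siteNorm (u - v) ≤ Xr := by
    rcases hu with rfl | rfl
    · rw [sub_self, siteNorm_zero]; exact hX0
    · exact le_rfl
  have huW : siteNorm u ≤ siteNorm v + siteNorm w := by
    rcases hu with rfl | rfl
    · linarith
    · linarith
  have hqv : siteNorm (q *ᵥ v) ≤ Λ * siteNorm v := hqΛ v
  have hqR' : siteNorm (q *ᵥ R') ≤ Λ * (C * Xr) := (hqΛ R').trans (mul_le_mul_of_nonneg_left hφ' hΛ)
  -- term 1: `c₀ R·qv`
  have t1 : |R ⬝ᵥ (q *ᵥ v)| ≤ C * Xr * (Λ * siteNorm v) :=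
    (abs_dot_le _ _).trans (mul_le_mul hφ hqv (siteNorm_nonneg _) (mul_nonneg hC hX0))
  -- term 2: `c₀ (u − v)·qv`
  have t2 : |(u - v) ⬝ᵥ (q *ᵥ v)| ≤ Xr * (Λ * siteNorm v) :=
    (abs_dot_le _ _).trans (mul_le_mul huv hqv (siteNorm_nonneg _) hX0)
  -- term 3: `(φ − u)·qR′`
  have hφu : siteNorm (φ - u) ≤ C * Xr + siteNorm v + (siteNorm v + siteNorm w) := by
    have e : φ - u = R + (c₀ • v - u) := by rw [hR]; abel
    rw [e]
    refine (siteNorm_add_le _ _).trans ?_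
    have h3 : siteNorm (c₀ • v - u) ≤ siteNorm (c₀ • v) + siteNorm u := siteNorm_sub_le _ _
    have h4 : siteNorm (c₀ • v) ≤ siteNorm v := by
      rw [siteNorm_smul, abs_of_nonneg hc₀]; exact mul_le_of_le_one_left hv0 hc₁
    linarith
  have t3 : |(φ - u) ⬝ᵥ (q *ᵥ R')| ≤ (C * Xr + siteNorm v + (siteNorm v + siteNorm w)) * (Λ * (C * Xr)) :=
    (abs_dot_le _ _).trans (mul_le_mul hφu hqR' (siteNorm_nonneg _) (by positivity))
  -- assemble
  rw [hid]
  have hc₀' : |c₀| ≤ 1 := by rw [abs_of_nonneg hc₀]; exact hc₁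
  calc |c₀ * (R ⬝ᵥ (q *ᵥ v) - (u - v) ⬝ᵥ (q *ᵥ v)) + (φ - u) ⬝ᵥ (q *ᵥ R')|
      ≤ |c₀| * (|R ⬝ᵥ (q *ᵥ v)| + |(u - v) ⬝ᵥ (q *ᵥ v)|) + |(φ - u) ⬝ᵥ (q *ᵥ R')| := by
        refine (abs_add_le _ _).trans (add_le_add ?_ le_rfl)
        rw [abs_mul]
        exact mul_le_mul_of_nonneg_left (abs_sub _ _) (abs_nonneg _)
    _ ≤ 1 * (C * Xr * (Λ * siteNorm v) + Xr * (Λ * siteNorm v))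
          + (C * Xr + siteNorm v + (siteNorm v + siteNorm w)) * (Λ * (C * Xr)) := by
        have hsum : 0 ≤ |R ⬝ᵥ (q *ᵥ v)| + |(u - v) ⬝ᵥ (q *ᵥ v)| := add_nonneg (abs_nonneg _) (abs_nonneg _)
        have hA : |c₀| * (|R ⬝ᵥ (q *ᵥ v)| + |(u - v) ⬝ᵥ (q *ᵥ v)|)
            ≤ 1 * (C * Xr * (Λ * siteNorm v) + Xr * (Λ * siteNorm v)) :=
          mul_le_mul hc₀' (add_le_add t1 t2) hsum zero_le_one
        linarith [hA, t3]
    _ ≤ Λ * (1 + 3 * C + C ^ 2) * Xr * (siteNorm v + siteNorm w) := by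
        have e : Λ * (1 + 3 * C + C ^ 2) * Xr * (siteNorm v + siteNorm w)
            = 1 * (C * Xr * (Λ * (siteNorm v + siteNorm w)) + Xr * (Λ * (siteNorm v + siteNorm w)))
              + (C * (siteNorm v + siteNorm w) + (siteNorm v + siteNorm w) + (siteNorm v + siteNorm w))
                * (Λ * (C * Xr)) := by ring
        rw [e]
        have hΛX : 0 ≤ Λ * (C * Xr) := by positivity
        have hvW : siteNorm v ≤ siteNorm v + siteNorm w := by linarith
        gcongr

end Pointwise

section Sums

variable {d : ℕ} {ι : Type} [Fintype ι] [DecidableEq ι]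

/-- at `A = 0` the first-order term (4.8) splits as `2·(first line) + 2·Σ_{y=x,x′}[(second line)_y − (third line)_y]`
with trivial transporters. [cite: Balaban1983RegularityDecay, (4.8) p.590 «with A₀ = 0»] -/
theorem firstOrder48_zero_split {X Y : Type*} [Fintype X] [Fintype Y] [DecidableEq X] [DecidableEq Y]
    (q : Matrix ι ι ℝ) (hq : qᵀ = -q) (κ : ℝ) (c : X → X → ℝ) (m2 a : ℝ) (qin qout : Y → X → ℝ) (emb : Y → X)
    (Γ : Y → X → List X) (ak : ℝ) (A' : X → X → ℝ) (Ψ : Y × ι → ℝ) :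
    firstOrder48 q hq κ c m2 a qin qout emb Γ ak 0 A' Ψ
      = 2 * (∑ x, ∑ y, c x y * (κ * A' x y)
            * ((fld (phiK0 q hq κ c m2 a qin qout emb Γ ak 0 Ψ) y - fld (phiK0 q hq κ c m2 a qin qout emb Γ ak 0 Ψ) x)
                ⬝ᵥ (q *ᵥ fld (phiK0 q hq κ c m2 a qin qout emb Γ ak 0 Ψ) x)))
        + 2 * ∑ y, (a * (fld (avgOp qin (fun _ _ => (1 : Matrix ι ι ℝ)) *ᵥ phiK0 q hq κ c m2 a qin qout emb Γ ak 0 Ψ) y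
                      ⬝ᵥ dAvg q hq κ qin emb Γ 0 A' (phiK0 q hq κ c m2 a qin qout emb Γ ak 0 Ψ) y)
                    - ak * (fld Ψ y ⬝ᵥ dAvg q hq κ qout emb Γ 0 A' (phiK0 q hq κ c m2 a qin qout emb Γ ak 0 Ψ) y)) := by
  unfold firstOrder48
  rw [contourTrans_zero, Finset.sum_sub_distrib, ← Finset.mul_sum, ← Finset.mul_sum]
  simp only [fieldLink_zero, Matrix.one_mulVec]
  ring

omit [DecidableEq ι] in
/-- **THE FIRST LINE OF (4.8) IS `O(1)·ε₁·X·W`** on the two-block box (`X = |U(A₀(⟨x,x′⟩))φ(x′) − φ(x)|`,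
`W = |φ(x)| + |φ(x′)|`, `ε₁ ≥ n|κA′_b| = |eA′_b|` on the bonds of `Δ(x,x′)`): from the second line of (4.9) on every bond
and the first line at every point, with the bond weights `n²/2`, the `2n^{d+1}` points of `Δ(x,x′)` with at most
`2(d+1)` neighbours each, and the normalisation `n^{−(d+1)/2}` of `φ^{(k)}`: `|Σ_{z,z′} c(z,z′)κA′(z,z′)[(φ^{(k)}(z′) −
φ^{(k)}(z))·qφ^{(k)}(z)]| ≤ 2(d+1)·ε₁·CΛ(1+C)·X·W`. [cite: Balaban1983RegularityDecay, (4.10) p.591] -/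
theorem line1_sum_bound {n : ℕ} (hn : 1 ≤ n) (μ : Fin (d + 1)) (q : Matrix ι ι ℝ) {Λ : ℝ} (hΛ : 0 ≤ Λ)
    (hqΛ : ∀ t, siteNorm (q *ᵥ t) ≤ Λ * siteNorm t) (κ : ℝ)
    (A' : ↥(boxDom (fun i => n * twoBlk μ i)) → ↥(boxDom (fun i => n * twoBlk μ i)) → ℝ) {ε₁ : ℝ}
    (hε₁ : 0 ≤ ε₁)
    (hA1 : ∀ x y : ↥(boxDom (fun i => n * twoBlk μ i)), y.1 ∈ nbrs x.1 → (n : ℝ) * |κ * A' x y| ≤ ε₁)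
    {C Xr Wr : ℝ} (hC : 0 ≤ C) (hX : 0 ≤ Xr) (hW : 0 ≤ Wr) (Φ : ↥(boxDom (fun i => n * twoBlk μ i)) → ι → ℝ)
    (hΦ1 : ∀ x y : ↥(boxDom (fun i => n * twoBlk μ i)), y.1 ∈ nbrs x.1 →
      (n : ℝ) * siteNorm (Φ y - Φ x) ≤ C * Xr)
    (hΦ2 : ∀ z, siteNorm (Φ z) ≤ (1 + C) * Wr)
    (P : ↥(boxDom (fun i => n * twoBlk μ i)) × ι → ℝ)
    (hP : ∀ z, fld P z = (Real.sqrt ((n : ℝ) ^ (d + 1)))⁻¹ • Φ z) :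
    |∑ x, ∑ y, boxWt n (fun i => n * twoBlk μ i) x y * (κ * A' x y) * ((fld P y - fld P x) ⬝ᵥ (q *ᵥ fld P x))|
      ≤ 2 * ((d : ℝ) + 1) * ε₁ * (C * Λ * (1 + C) * Xr * Wr) := by
  set s : ℝ := (Real.sqrt ((n : ℝ) ^ (d + 1)))⁻¹ with hs
  have hn' : (0 : ℝ) ≤ n := Nat.cast_nonneg n
  have hm : (0 : ℝ) < (n : ℝ) ^ (d + 1) := by
    have : (0 : ℝ) < n := by exact_mod_cast (show 0 < n by omega)
    positivity
  have hs2 : s * s * (n : ℝ) ^ (d + 1) = 1 := by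
    rw [hs, ← mul_inv, Real.mul_self_sqrt hm.le, inv_mul_cancel₀ hm.ne']
  have hs0 : 0 ≤ s * s := mul_self_nonneg s
  set B : ℝ := s * s / 2 * (ε₁ * (C * Λ * (1 + C) * Xr * Wr)) with hB
  -- every term is bounded by `B` on bonds and vanishes off bonds
  have hterm : ∀ x y : ↥(boxDom (fun i => n * twoBlk μ i)),
      |boxWt n (fun i => n * twoBlk μ i) x y * (κ * A' x y) * ((fld P y - fld P x) ⬝ᵥ (q *ᵥ fld P x))|
        ≤ if y.1 ∈ nbrs x.1 then B else 0 := by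
    intro x y
    rw [hP, hP]
    by_cases hnb : y.1 ∈ nbrs x.1
    · rw [if_pos hnb]
      have hw : boxWt n (fun i => n * twoBlk μ i) x y = (n : ℝ) ^ 2 / 2 := by
        unfold boxWt; rw [if_pos hnb, mul_one]
      have hsc : (s • Φ y - s • Φ x) ⬝ᵥ (q *ᵥ (s • Φ x)) = s * s * ((Φ y - Φ x) ⬝ᵥ (q *ᵥ Φ x)) := by
        rw [← smul_sub, Matrix.mulVec_smul, smul_dotProduct, dotProduct_smul, smul_eq_mul, smul_eq_mul]
        ring
      rw [hw, hsc]
      have hb := bond_term_bound hΛ hqΛ hn' hC hX (hΦ1 x y hnb) (hΦ2 x)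
      have ha := hA1 x y hnb
      have hD : 0 ≤ (n : ℝ) * |(Φ y - Φ x) ⬝ᵥ (q *ᵥ Φ x)| := mul_nonneg hn' (abs_nonneg _)
      rw [abs_mul ((n : ℝ) ^ 2 / 2 * (κ * A' x y)) (s * s * ((Φ y - Φ x) ⬝ᵥ (q *ᵥ Φ x))),
        abs_mul ((n : ℝ) ^ 2 / 2) (κ * A' x y), abs_mul (s * s) ((Φ y - Φ x) ⬝ᵥ (q *ᵥ Φ x)),
        abs_of_nonneg (by positivity : (0 : ℝ) ≤ (n : ℝ) ^ 2 / 2), abs_of_nonneg hs0]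
      calc (n : ℝ) ^ 2 / 2 * |κ * A' x y| * (s * s * |(Φ y - Φ x) ⬝ᵥ (q *ᵥ Φ x)|)
          = s * s / 2 * (((n : ℝ) * |κ * A' x y|) * ((n : ℝ) * |(Φ y - Φ x) ⬝ᵥ (q *ᵥ Φ x)|)) := by ring
        _ ≤ s * s / 2 * (ε₁ * (C * Λ * (1 + C) * Xr * Wr)) :=
          mul_le_mul_of_nonneg_left (mul_le_mul ha hb hD hε₁) (by positivity)
    · rw [if_neg hnb]
      have hw : boxWt n (fun i => n * twoBlk μ i) x y = 0 := by
        unfold boxWt; rw [if_neg hnb, mul_zero]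
      rw [hw, zero_mul, zero_mul, abs_zero]
  have hB0 : 0 ≤ B := by positivity
  have hcount : ∀ x : ↥(boxDom (fun i => n * twoBlk μ i)),
      ∑ y : ↥(boxDom (fun i => n * twoBlk μ i)), (if y.1 ∈ nbrs x.1 then B else 0) ≤ 2 * ((d : ℝ) + 1) * B := by
    intro x
    rw [Finset.sum_ite, Finset.sum_const_zero, add_zero, Finset.sum_const, nsmul_eq_mul]
    exact mul_le_mul_of_nonneg_right (card_nbrs_box_le μ x) hB0
  -- sum over `y`: at most `2(d+1)` neighbours; sum over `x`: `2n^{d+1}` points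
  calc |∑ x, ∑ y, boxWt n (fun i => n * twoBlk μ i) x y * (κ * A' x y) * ((fld P y - fld P x) ⬝ᵥ (q *ᵥ fld P x))|
      ≤ ∑ x : ↥(boxDom (fun i => n * twoBlk μ i)), ∑ y : ↥(boxDom (fun i => n * twoBlk μ i)),
          (if y.1 ∈ nbrs x.1 then B else 0) := by
        refine (Finset.abs_sum_le_sum_abs _ _).trans (Finset.sum_le_sum fun x _ => ?_)
        exact (Finset.abs_sum_le_sum_abs _ _).trans (Finset.sum_le_sum fun y _ => hterm x y)
    _ ≤ ∑ _x : ↥(boxDom (fun i => n * twoBlk μ i)), 2 * ((d : ℝ) + 1) * B :=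
        Finset.sum_le_sum fun x _ => hcount x
    _ = 2 * (n : ℝ) ^ (d + 1) * (2 * ((d : ℝ) + 1) * B) := by
        rw [Finset.sum_const, nsmul_eq_mul, Finset.card_univ, card_box hn μ]
    _ = 2 * ((d : ℝ) + 1) * ε₁ * (C * Λ * (1 + C) * Xr * Wr) * (s * s * (n : ℝ) ^ (d + 1)) := by
        rw [hB]; ring
    _ = 2 * ((d : ℝ) + 1) * ε₁ * (C * Λ * (1 + C) * Xr * Wr) := by rw [hs2, mul_one]

/-- **THE SECOND AND THIRD LINES OF (4.8) TOGETHER ARE `O(1)·ε₂·X·W`** on the two-block box (`ε₂ ≥ |κA′(Γ_{y,z})| =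
|eηA′(Γ^{(k)}_{y,z})|` on the block contours): with `(1/|B^k(y)|)Σ_{z∈B^k(y)}` the block average, the two lines combine
into `2a_k n^{−(d+1)}·Σ_y Σ_{z,z′∈B^k(y)} κA′(Γ_{y,z′})·[(φ^{(k)}(z) − φ(y))·qφ^{(k)}(z′)]`, each bracket bounded by
`block_term_bound` (this is where «φ(x)·qφ(x) = 0» kills the leading term): the sum is `≤ 2a_k·ε₂·M`.
[cite: Balaban1983RegularityDecay, (4.10) p.591] -/
theorem line23_sum_bound {n : ℕ} (hn : 1 ≤ n) (μ : Fin (d + 1)) (q : Matrix ι ι ℝ) (hq : qᵀ = -q) (κ : ℝ)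
    {a : ℝ} (ha : 0 ≤ a) (emb : ↥(boxDom (twoBlk μ)) → ↥(boxDom (fun i => n * twoBlk μ i)))
    (Γ : ↥(boxDom (twoBlk μ)) → ↥(boxDom (fun i => n * twoBlk μ i)) → List ↥(boxDom (fun i => n * twoBlk μ i)))
    (A' : ↥(boxDom (fun i => n * twoBlk μ i)) → ↥(boxDom (fun i => n * twoBlk μ i)) → ℝ) {ε₂ : ℝ}
    (hε₂ : 0 ≤ ε₂)
    (hA2 : ∀ (y : ↥(boxDom (twoBlk μ))) (x : ↥(boxDom (fun i => n * twoBlk μ i))), blk n x.1 = y.1 →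
      |κ * lsum A' (emb y) (Γ y x)| ≤ ε₂)
    {M : ℝ} (Φ : ↥(boxDom (fun i => n * twoBlk μ i)) → ι → ℝ)
    (Ψ : ↥(boxDom (twoBlk μ)) × ι → ℝ)
    (hpair : ∀ (y : ↥(boxDom (twoBlk μ))) (x x' : ↥(boxDom (fun i => n * twoBlk μ i))),
      |(Φ x - fld Ψ y) ⬝ᵥ (q *ᵥ Φ x')| ≤ M)
    (P : ↥(boxDom (fun i => n * twoBlk μ i)) × ι → ℝ)
    (hP : ∀ z, fld P z = (Real.sqrt ((n : ℝ) ^ (d + 1)))⁻¹ • Φ z) :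
    |∑ y, (a * ((n : ℝ) ^ (d + 1))⁻¹
          * (fld (avgOp (blkWt n (twoBlk μ) (fun i => n * twoBlk μ i)) (fun _ _ => (1 : Matrix ι ι ℝ)) *ᵥ P) y
              ⬝ᵥ dAvg q hq κ (blkWt n (twoBlk μ) (fun i => n * twoBlk μ i)) emb Γ 0 A' P y)
        - a * (fld Ψ y ⬝ᵥ dAvg q hq κ (outWtB n μ) emb Γ 0 A' P y))|
      ≤ 2 * a * ε₂ * M := by
  set s : ℝ := (Real.sqrt ((n : ℝ) ^ (d + 1)))⁻¹ with hs
  set m : ℝ := (n : ℝ) ^ (d + 1) with hmdef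
  have hm : 0 < m := by
    have : (0 : ℝ) < n := by exact_mod_cast (show 0 < n by omega)
    rw [hmdef]; positivity
  have hs2 : s * s = m⁻¹ := by
    rw [hs, ← mul_inv, Real.mul_self_sqrt hm.le]
  set ω : ↥(boxDom (twoBlk μ)) → ↥(boxDom (fun i => n * twoBlk μ i)) → ℝ :=
    blkWt n (twoBlk μ) (fun i => n * twoBlk μ i) with hω
  set ℓ : ↥(boxDom (twoBlk μ)) → ↥(boxDom (fun i => n * twoBlk μ i)) → ℝ :=
    fun y x => κ * lsum A' (emb y) (Γ y x) with hℓ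
  set G : ↥(boxDom (twoBlk μ)) → ι → ℝ := fun y => ∑ x', (ω y x' * ℓ y x') • (q *ᵥ Φ x') with hG
  set BΦ : ↥(boxDom (twoBlk μ)) → ι → ℝ := fun y => ∑ x, ω y x • Φ x with hBΦ
  have hωsum : ∀ y, ∑ x, ω y x = m := fun y => sum_blkWt_box hn μ y
  have hω0 : ∀ y x, 0 ≤ ω y x := by
    intro y x; simp only [hω, blkWt]; split_ifs <;> norm_num
  have hωℓ : ∀ y x, ω y x * |ℓ y x| ≤ ω y x * ε₂ := by
    intro y x
    by_cases hb : blk n x.1 = y.1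
    · exact mul_le_mul_of_nonneg_left (hA2 y x hb) (hω0 y x)
    · have : ω y x = 0 := by simp only [hω, blkWt, if_neg hb]
      rw [this, zero_mul, zero_mul]
  -- the three block quantities at `A = 0`
  have hB : ∀ y, fld (avgOp ω (fun _ _ => (1 : Matrix ι ι ℝ)) *ᵥ P) y = s • BΦ y := by
    intro y
    rw [fld_avgOp_mulVec, hBΦ, Finset.smul_sum]
    refine Finset.sum_congr rfl fun x _ => ?_
    rw [Matrix.one_mulVec, hP, smul_comm]
  have hD : ∀ y, dAvg q hq κ ω emb Γ 0 A' P y = s • G y := by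
    intro y
    rw [dAvg_zero, hG, Finset.smul_sum]
    refine Finset.sum_congr rfl fun x _ => ?_
    rw [hP, Matrix.mulVec_smul, smul_comm]
  have hD' : ∀ y, dAvg q hq κ (outWtB n μ) emb Γ 0 A' P y = (s * s) • G y := by
    intro y
    rw [dAvg_zero, hG, Finset.smul_sum]
    refine Finset.sum_congr rfl fun x _ => ?_
    rw [hP, Matrix.mulVec_smul, smul_smul, smul_smul]
    congr 1
    simp only [outWtB, hs, hω, hℓ]
    ring
  -- the combination: `a m⁻¹ (sB)·(sG) − a u·(s²G) = a s² m⁻¹ Σ_x Σ_x′ ω_x ω_x′ ℓ_x′ (Φ_x − u)·qΦ_x′`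
  have key : ∀ y, a * m⁻¹ * ((s • BΦ y) ⬝ᵥ (s • G y)) - a * (fld Ψ y ⬝ᵥ ((s * s) • G y))
      = a * (s * s) * m⁻¹ * ∑ x, ∑ x', ω y x * (ω y x' * ℓ y x') * ((Φ x - fld Ψ y) ⬝ᵥ (q *ᵥ Φ x')) := by
    intro y
    have e1 : ∑ x, ∑ x', ω y x * (ω y x' * ℓ y x') * ((Φ x - fld Ψ y) ⬝ᵥ (q *ᵥ Φ x'))
        = (∑ x, ω y x • (Φ x - fld Ψ y)) ⬝ᵥ G y := by
      rw [sum_dotProduct]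
      refine Finset.sum_congr rfl fun x _ => ?_
      rw [smul_dotProduct, hG, dotProduct_sum, smul_eq_mul, Finset.mul_sum]
      refine Finset.sum_congr rfl fun x' _ => ?_
      rw [dotProduct_smul, smul_eq_mul]
      ring
    have e2 : ∑ x, ω y x • (Φ x - fld Ψ y) = BΦ y - m • fld Ψ y := by
      simp only [smul_sub, Finset.sum_sub_distrib, ← Finset.sum_smul, hωsum, hBΦ]
    rw [e1, e2, sub_dotProduct]
    simp only [smul_dotProduct, dotProduct_smul, smul_eq_mul]
    field_simp
  -- per-`y` bound
  have hy : ∀ y, |a * m⁻¹ * (fld (avgOp ω (fun _ _ => (1 : Matrix ι ι ℝ)) *ᵥ P) y ⬝ᵥ dAvg q hq κ ω emb Γ 0 A' P y)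
      - a * (fld Ψ y ⬝ᵥ dAvg q hq κ (outWtB n μ) emb Γ 0 A' P y)| ≤ a * ε₂ * M := by
    intro y
    rw [hB, hD, hD', key]
    have hsum : |∑ x, ∑ x', ω y x * (ω y x' * ℓ y x') * ((Φ x - fld Ψ y) ⬝ᵥ (q *ᵥ Φ x'))| ≤ m * (m * (ε₂ * M)) := by
      calc |∑ x, ∑ x', ω y x * (ω y x' * ℓ y x') * ((Φ x - fld Ψ y) ⬝ᵥ (q *ᵥ Φ x'))|
          ≤ ∑ x, ∑ x', ω y x * (ω y x' * ε₂ * M) := by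
            refine (Finset.abs_sum_le_sum_abs _ _).trans (Finset.sum_le_sum fun x _ => ?_)
            refine (Finset.abs_sum_le_sum_abs _ _).trans (Finset.sum_le_sum fun x' _ => ?_)
            rw [abs_mul (ω y x * (ω y x' * ℓ y x')) ((Φ x - fld Ψ y) ⬝ᵥ (q *ᵥ Φ x')),
              abs_mul (ω y x) (ω y x' * ℓ y x'), abs_mul (ω y x') (ℓ y x'), abs_of_nonneg (hω0 y x),
              abs_of_nonneg (hω0 y x')]
            have h3 := mul_le_mul (hωℓ y x') (hpair y x x') (abs_nonneg _) (mul_nonneg (hω0 y x') hε₂)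
            calc ω y x * (ω y x' * |ℓ y x'|) * |(Φ x - fld Ψ y) ⬝ᵥ (q *ᵥ Φ x')|
                = ω y x * ((ω y x' * |ℓ y x'|) * |(Φ x - fld Ψ y) ⬝ᵥ (q *ᵥ Φ x')|) := by ring
              _ ≤ ω y x * ((ω y x' * ε₂) * M) := mul_le_mul_of_nonneg_left h3 (hω0 y x)
              _ = ω y x * (ω y x' * ε₂ * M) := by ring
        _ = m * (m * (ε₂ * M)) := by
            have h1 : ∀ x', ω y x' * ε₂ * M = ω y x' * (ε₂ * M) := fun x' => by ring
            simp_rw [h1, ← Finset.mul_sum, ← Finset.sum_mul, hωsum]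
    have hpre : 0 ≤ a * (s * s) * m⁻¹ := by rw [hs2]; positivity
    rw [abs_mul, abs_of_nonneg hpre]
    calc a * (s * s) * m⁻¹ * |∑ x, ∑ x', ω y x * (ω y x' * ℓ y x') * ((Φ x - fld Ψ y) ⬝ᵥ (q *ᵥ Φ x'))|
        ≤ a * (s * s) * m⁻¹ * (m * (m * (ε₂ * M))) := mul_le_mul_of_nonneg_left hsum hpre
      _ = a * ε₂ * M := by rw [hs2]; field_simp
  -- two labels
  calc |∑ y, (a * m⁻¹ * (fld (avgOp ω (fun _ _ => (1 : Matrix ι ι ℝ)) *ᵥ P) y ⬝ᵥ dAvg q hq κ ω emb Γ 0 A' P y)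
          - a * (fld Ψ y ⬝ᵥ dAvg q hq κ (outWtB n μ) emb Γ 0 A' P y))|
      ≤ ∑ y, a * ε₂ * M := (Finset.abs_sum_le_sum_abs _ _).trans (Finset.sum_le_sum fun y _ => hy y)
    _ = 2 * a * ε₂ * M := by rw [sum_Y]; ring

end Sums

/-! ## §5. (4.10), first inequality, on the two-block region — at `A₀ = 0` with the gauged data, at a constant
`A₀`, and with the δ-splitting of its right member -/

section Main

variable {d : ℕ} {ι : Type} [Fintype ι] [DecidableEq ι]

/-- the scalar part of [B4]'s operator (1.6) on the two-block box is invertible (`a_k > 0`, `m² ≥ 0`; (1.8) at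
`A = 0`, lineage `B4BoxCov237.boxOpR_det_isUnit`). [cite: Balaban1983RegularityDecay, (1.8) p.573] -/
theorem scalarOp_box_isUnit {n : ℕ} (hn : 1 ≤ n) {a m2 : ℝ} (ha : 0 < a) (hm : 0 ≤ m2) (μ : Fin (d + 1)) :
    IsUnit (scalarOp (boxWt n (fun i => n * twoBlk μ i)) m2 (a * ((n : ℝ) ^ (d + 1))⁻¹)
      (blkWt n (twoBlk μ) (fun i => n * twoBlk μ i))).det := by
  rw [scalarOp_box hn]
  exact boxOpR_det_isUnit hn ha hm (one_le_twoBlk μ)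

/-- **(4.8) IS THE FIRST-ORDER TERM OF THE LEFT SIDE OF (4.7) ON THE TWO-BLOCK REGION, HYPOTHESIS-FREE** at every
constant background `A₀` (integer site positions), every scale `n ≥ 1`, `a_k > 0`, `m² ≥ 0`, every block embedding
and admissible contour system: `d/dt|₀ lhs47Box(A₀ + tA′, φ) = firstOrder48Box(A₀, A′, φ)` — the box-carrier twin
of `B4Eq48FirstOrder.hasDerivAt_lhs47_fineDom` (invertibility from (1.8) at `A = 0` and gauge covariance).
[cite: Balaban1983RegularityDecay, (4.7)–(4.8) p.590] -/
theorem hasDerivAt_lhs47Box {n : ℕ} (hn : 1 ≤ n) {a m2 : ℝ} (ha : 0 < a) (hm : 0 ≤ m2) (μ : Fin (d + 1))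
    (q : Matrix ι ι ℝ) (hq : qᵀ = -q) (κ : ℝ) {emb : ↥(boxDom (twoBlk μ)) → ↥(boxDom (fun i => n * twoBlk μ i))}
    {Γ : ↥(boxDom (twoBlk μ)) → ↥(boxDom (fun i => n * twoBlk μ i)) → List ↥(boxDom (fun i => n * twoBlk μ i))}
    (hend : ∀ y x, blkWt n (twoBlk μ) (fun i => n * twoBlk μ i) y x ≠ 0 → pathEnd (emb y) (Γ y x) = x)
    (A₀ : Fin (d + 1) → ℝ)
    (A' : ↥(boxDom (fun i => n * twoBlk μ i)) → ↥(boxDom (fun i => n * twoBlk μ i)) → ℝ)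
    (Ψ : ↥(boxDom (twoBlk μ)) × ι → ℝ) :
    HasDerivAt (fun t : ℝ => lhs47Box (expFlow q hq) κ n a m2 μ emb Γ (constBond A₀ Subtype.val + t • A') Ψ)
      (firstOrder48Box q hq κ n a m2 μ emb Γ (constBond A₀ Subtype.val) A' Ψ) 0 := by
  unfold lhs47Box firstOrder48Box
  exact hasDerivAt_lhs47 q hq κ _ m2 _ _ _ emb Γ a _ A' Ψ
    (isUnit_b4Op_constBond (expFlow q hq) κ _ m2 _ hend (scalarOp_box_isUnit hn ha hm μ) A₀ Subtype.val)

/-- **[B4] (4.10), FIRST INEQUALITY — KERNEL FORM AT `A₀` GAUGED AWAY.**  p. 591: *"and this implies the following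
estimate |(the expression (4.8))| ≤ |(4a_k/(1+m²)²)[φ(x)·qφ(x)]Σ_{y=x,x′}Σ_{z∈B^k(y)}η^deηA′(Γ_{y,z}) −
(4a_k/(1+m²))[φ(x)·qφ(x)]Σ_{y=x,x′}Σ_{z∈B^k(y)}η^deηA′(Γ_{y,z})| + O(1)ep(e)|U(A₀(⟨x,x′⟩))φ(x′) − φ(x)|(|φ(x)| +
|φ(x′)|) … (φ(x)·qφ(x) = 0 because q is an antisymmetric matrix)"*.  For every dimension `d + 1`, every
antisymmetric charge matrix `q` of (1.2) and every window `a_k ∈ [a₋,a₊]` (`a₋ > 0`), `m² ∈ [0,m²₊]` there is ONE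
constant `K ≥ 0` such that for EVERY scale `n = L^k ≥ 1`, every direction `μ` of the unit bond `⟨x,x′⟩`, every
coupling `κ = eη`, every block embedding and contour system, every field `A′` on the two-block region `Δ(x,x′)` with
`n·|κA′_b| ≤ ε₁` on its bonds (print: `|eA′_b|`, `A′` «satisfying the bounds |A′|, |∂^η_μA′| ≤ O(1)p(e)») and
`|κA′(Γ_{y,z})| ≤ ε₂` on its block contours (print: `|eηA′(Γ^{(k)}_{y,z})|`), and every two-site field `φ″` (the
gauged data `φ″(x) = φ(x) = v`, `φ″(x′) = U(A₀(⟨x,x′⟩))φ(x′) = w`):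
`|(4.8) at A₀ = 0| ≤ K·(ε₁ + ε₂)·|w − v|·(|v| + |w|)`.
The two bracketed terms of the print vanish identically (`B4Ineq410GaugeOut.first_order_terms_eq_zero`) and do not
appear; `K = 4(d+1)CΛ(1+C) + 4max(a₊,0)Λ(1+3C+C²)` with `C` the constant of (4.9) (`B4Eq49TwoBlockGreen.eq49`) and
`Λ = ‖q‖_F`. [cite: Balaban1983RegularityDecay, (4.10) p.591] -/
theorem ineq410_first_zero (d : ℕ) (q : Matrix ι ι ℝ) (hq : qᵀ = -q) (aminus aplus m2plus : ℝ)
    (ha : 0 < aminus) :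
    ∃ K : ℝ, 0 ≤ K ∧ ∀ (n : ℕ) (hn : 1 ≤ n) (a m2 : ℝ), aminus ≤ a → a ≤ aplus → 0 ≤ m2 → m2 ≤ m2plus →
      ∀ (μ : Fin (d + 1)) (κ : ℝ) (emb : ↥(boxDom (twoBlk μ)) → ↥(boxDom (fun i => n * twoBlk μ i)))
        (Γ : ↥(boxDom (twoBlk μ)) → ↥(boxDom (fun i => n * twoBlk μ i)) → List ↥(boxDom (fun i => n * twoBlk μ i)))
        (A' : ↥(boxDom (fun i => n * twoBlk μ i)) → ↥(boxDom (fun i => n * twoBlk μ i)) → ℝ) (ε₁ ε₂ : ℝ),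
        0 ≤ ε₁ → 0 ≤ ε₂ →
        (∀ x y : ↥(boxDom (fun i => n * twoBlk μ i)), y.1 ∈ nbrs x.1 → (n : ℝ) * |κ * A' x y| ≤ ε₁) →
        (∀ (y : ↥(boxDom (twoBlk μ))) (x : ↥(boxDom (fun i => n * twoBlk μ i))), blk n x.1 = y.1 →
          |κ * lsum A' (emb y) (Γ y x)| ≤ ε₂) →
        ∀ Ψ : ↥(boxDom (twoBlk μ)) × ι → ℝ,
          |firstOrder48Box q hq κ n a m2 μ emb Γ 0 A' Ψ|
            ≤ K * (ε₁ + ε₂) * siteNorm (fld Ψ (siteX' μ) - fld Ψ (siteX μ))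
                * (siteNorm (fld Ψ (siteX μ)) + siteNorm (fld Ψ (siteX' μ))) := by
  obtain ⟨C, hC, h49⟩ := eq49 (ι := ι) d aminus aplus m2plus ha
  set Λ : ℝ := Real.sqrt (∑ i, ∑ j, q i j ^ 2) with hΛdef
  have hΛ : 0 ≤ Λ := Real.sqrt_nonneg _
  have hqΛ : ∀ t, siteNorm (q *ᵥ t) ≤ Λ * siteNorm t := siteNorm_mulVec_le q
  refine ⟨4 * ((d : ℝ) + 1) * (C * Λ * (1 + C)) + 4 * max aplus 0 * (Λ * (1 + 3 * C + C ^ 2)),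
    by positivity, ?_⟩
  intro n hn a m2 h1 h2 h3 h4 μ κ emb Γ A' ε₁ ε₂ hε₁ hε₂ hA1 hA2 Ψ
  have ha' : 0 < a := lt_of_lt_of_le ha h1
  have haM : a ≤ max aplus 0 := h2.trans (le_max_left _ _)
  set v : ι → ℝ := fld Ψ (siteX μ) with hv
  set w : ι → ℝ := fld Ψ (siteX' μ) with hw
  set Φ : ↥(boxDom (fun i => n * twoBlk μ i)) → ι → ℝ := fun z i => phiK n a m2 μ v w z i with hΦ
  set c₀ : ℝ := a / (a + m2) with hc₀def
  have hc₀ : 0 ≤ c₀ := by rw [hc₀def]; positivity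
  have hc₁ : c₀ ≤ 1 := by
    rw [hc₀def, div_le_one (by linarith)]; linarith
  have h49' := h49 n hn a m2 h1 h2 h3 h4 μ v w
  -- (4.9) in norm form
  have E1 : ∀ z, siteNorm (Φ z - c₀ • v) ≤ C * siteNorm (w - v) := by
    intro z
    refine siteNorm_le_of_abs_le hC fun i => ?_
    have h := (h49' i).1 z
    simpa only [hΦ, hc₀def, Pi.sub_apply, Pi.smul_apply, smul_eq_mul] using h
  have E2 : ∀ x y : ↥(boxDom (fun i => n * twoBlk μ i)), y.1 ∈ nbrs x.1 →
      (n : ℝ) * siteNorm (Φ y - Φ x) ≤ C * siteNorm (w - v) := by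
    have key : ∀ (ν : Fin (d + 1)) (z ze : ↥(boxDom (fun i => n * twoBlk μ i))), ze.1 = z.1 + Pi.single ν 1 →
        (n : ℝ) * siteNorm (Φ ze - Φ z) ≤ C * siteNorm (w - v) := by
      intro ν z ze hze
      have h : siteNorm ((n : ℝ) • (Φ ze - Φ z)) ≤ C * siteNorm (w - v) := by
        refine siteNorm_le_of_abs_le hC fun i => ?_
        have h := (h49' i).2 ν z ze hze
        simpa only [hΦ, Pi.smul_apply, Pi.sub_apply, smul_eq_mul] using h
      rwa [siteNorm_smul, abs_of_nonneg (Nat.cast_nonneg n)] at h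
    intro x y hxy
    obtain ⟨ν, h | h⟩ := mem_nbrs.1 hxy
    · exact key ν x y h
    · have h' : x.1 = y.1 + Pi.single ν 1 := by rw [h, sub_add_cancel]
      rw [siteNorm_sub_comm]
      exact key ν y x h'
  have hXW : siteNorm (w - v) ≤ siteNorm v + siteNorm w := by
    rw [siteNorm_sub_comm]; exact siteNorm_sub_le v w
  have E3 : ∀ z, siteNorm (Φ z) ≤ (1 + C) * (siteNorm v + siteNorm w) := by
    intro z
    have h1' := siteNorm_add_le (c₀ • v) (Φ z - c₀ • v)
    rw [add_sub_cancel] at h1'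
    have h2' : siteNorm (c₀ • v) ≤ siteNorm v := by
      rw [siteNorm_smul, abs_of_nonneg hc₀]; exact mul_le_of_le_one_left (siteNorm_nonneg v) hc₁
    have h3' := E1 z
    have h4' : C * siteNorm (w - v) ≤ C * (siteNorm v + siteNorm w) := mul_le_mul_of_nonneg_left hXW hC
    nlinarith [siteNorm_nonneg w]
  -- the field `φ^{(k)}` of (4.8) and the split
  have hP := fld_phiK0_box q hq κ hn ha' h3 μ emb Γ Ψ
  have hu : ∀ y : ↥(boxDom (twoBlk μ)), fld Ψ y = v ∨ fld Ψ y = w := by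
    intro y
    rcases eq_siteX_or μ y with rfl | rfl
    · exact Or.inl rfl
    · exact Or.inr rfl
  have hpair : ∀ (y : ↥(boxDom (twoBlk μ))) (x x' : ↥(boxDom (fun i => n * twoBlk μ i))),
      |(Φ x - fld Ψ y) ⬝ᵥ (q *ᵥ Φ x')|
        ≤ Λ * (1 + 3 * C + C ^ 2) * siteNorm (w - v) * (siteNorm v + siteNorm w) :=
    fun y x x' => block_term_bound hq hΛ hqΛ hC hc₀ hc₁ v w (fld Ψ y) (Φ x) (Φ x') (hu y) (E1 x) (E1 x')
  have hL1 := line1_sum_bound hn μ q hΛ hqΛ κ A' hε₁ hA1 hC (siteNorm_nonneg (w - v))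
    (add_nonneg (siteNorm_nonneg v) (siteNorm_nonneg w)) Φ E2 E3 _ hP
  have hL23 := line23_sum_bound hn μ q hq κ ha'.le emb Γ A' hε₂ hA2 Φ Ψ hpair _ hP
  rw [firstOrder48Box, firstOrder48_zero_split]
  refine (abs_add_le _ _).trans ?_
  rw [abs_mul, abs_mul, abs_two]
  have hX0 : 0 ≤ siteNorm (w - v) := siteNorm_nonneg _
  have hW0 : 0 ≤ siteNorm v + siteNorm w := add_nonneg (siteNorm_nonneg v) (siteNorm_nonneg w)
  have hM2n : 0 ≤ Λ * (1 + 3 * C + C ^ 2) * siteNorm (w - v) * (siteNorm v + siteNorm w) :=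
    mul_nonneg (mul_nonneg (mul_nonneg hΛ (by positivity)) hX0) hW0
  have hM1n : 0 ≤ C * Λ * (1 + C) * siteNorm (w - v) * (siteNorm v + siteNorm w) :=
    mul_nonneg (mul_nonneg (by positivity) hX0) hW0
  have hM2 : 0 ≤ ε₂ * (Λ * (1 + 3 * C + C ^ 2) * siteNorm (w - v) * (siteNorm v + siteNorm w)) :=
    mul_nonneg hε₂ hM2n
  have hL23' : 2 * a * ε₂ * (Λ * (1 + 3 * C + C ^ 2) * siteNorm (w - v) * (siteNorm v + siteNorm w))
      ≤ 2 * max aplus 0 * ε₂ * (Λ * (1 + 3 * C + C ^ 2) * siteNorm (w - v) * (siteNorm v + siteNorm w)) := by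
    have := mul_le_mul_of_nonneg_right haM hM2
    nlinarith
  have hx1 : 0 ≤ ε₂ * (C * Λ * (1 + C) * siteNorm (w - v) * (siteNorm v + siteNorm w)) := mul_nonneg hε₂ hM1n
  have hx2 : 0 ≤ ε₁ * (Λ * (1 + 3 * C + C ^ 2) * siteNorm (w - v) * (siteNorm v + siteNorm w)) :=
    mul_nonneg hε₁ hM2n
  have hx3 : 0 ≤ max aplus 0 := le_max_right _ _
  nlinarith [hL1, hL23, hL23', hx1, hx2, mul_nonneg hx3 hx2]

/-- **[B4] (4.10) AS PRINTED (its outer inequality), KERNEL FORM AT `A₀` GAUGED AWAY**: with the constant `K` of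
`ineq410_first_zero`, for every `δ > 0`,
`|(4.8)| ≤ δ|w − v|² + (K²/(2δ))·(ε₁+ε₂)²·(|v|² + |w|²)` — print: *"≤ δ|U(A₀(⟨x,x′⟩))φ(x′) − φ(x)|² +
O(δ^{−1})e²p²(e)(|φ(x)|² + |φ(x′)|²) … for arbitrary δ > 0. (4.10)"* (the δ-splitting is r01's
`B4Ineq410GaugeOut.delta_split`; `(ε₁ + ε₂)² = O(1)e²p²(e)`). [cite: Balaban1983RegularityDecay, (4.10) p.591] -/
theorem ineq410_delta_zero (d : ℕ) (q : Matrix ι ι ℝ) (hq : qᵀ = -q) (aminus aplus m2plus : ℝ)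
    (ha : 0 < aminus) :
    ∃ K : ℝ, 0 ≤ K ∧ ∀ (n : ℕ) (hn : 1 ≤ n) (a m2 : ℝ), aminus ≤ a → a ≤ aplus → 0 ≤ m2 → m2 ≤ m2plus →
      ∀ (μ : Fin (d + 1)) (κ : ℝ) (emb : ↥(boxDom (twoBlk μ)) → ↥(boxDom (fun i => n * twoBlk μ i)))
        (Γ : ↥(boxDom (twoBlk μ)) → ↥(boxDom (fun i => n * twoBlk μ i)) → List ↥(boxDom (fun i => n * twoBlk μ i)))
        (A' : ↥(boxDom (fun i => n * twoBlk μ i)) → ↥(boxDom (fun i => n * twoBlk μ i)) → ℝ) (ε₁ ε₂ : ℝ),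
        0 ≤ ε₁ → 0 ≤ ε₂ →
        (∀ x y : ↥(boxDom (fun i => n * twoBlk μ i)), y.1 ∈ nbrs x.1 → (n : ℝ) * |κ * A' x y| ≤ ε₁) →
        (∀ (y : ↥(boxDom (twoBlk μ))) (x : ↥(boxDom (fun i => n * twoBlk μ i))), blk n x.1 = y.1 →
          |κ * lsum A' (emb y) (Γ y x)| ≤ ε₂) →
        ∀ (Ψ : ↥(boxDom (twoBlk μ)) × ι → ℝ) (δ : ℝ), 0 < δ →
          |firstOrder48Box q hq κ n a m2 μ emb Γ 0 A' Ψ|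
            ≤ δ * siteNorm (fld Ψ (siteX' μ) - fld Ψ (siteX μ)) ^ 2
              + K ^ 2 / (2 * δ) * (ε₁ + ε₂) ^ 2
                  * (siteNorm (fld Ψ (siteX μ)) ^ 2 + siteNorm (fld Ψ (siteX' μ)) ^ 2) := by
  obtain ⟨K, hK, h⟩ := ineq410_first_zero d q hq aminus aplus m2plus ha
  refine ⟨K, hK, ?_⟩
  intro n hn a m2 h1 h2 h3 h4 μ κ emb Γ A' ε₁ ε₂ hε₁ hε₂ hA1 hA2 Ψ δ hδ
  exact (h n hn a m2 h1 h2 h3 h4 μ κ emb Γ A' ε₁ ε₂ hε₁ hε₂ hA1 hA2 Ψ).trans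
    (delta_split K (ε₁ + ε₂) _ _ _ hδ)

/-- **[B4] (4.10), FIRST INEQUALITY, AT A CONSTANT BACKGROUND `A₀`** — the print's own route: «we can "gauge away"
the configuration A₀ … φ(x), φ(x′) replaced by φ(x), U(A₀(⟨x,x′⟩))φ(x′)» (`firstOrder48_constBond`) and then the
estimate at `A₀ = 0` (`ineq410_first_zero`); `|U(A₀(⟨x,x′⟩))φ(x′)| = |φ(x′)|` by orthogonality.  For the constant field
`A₀` on `Δ(x,x′)` (integer site positions), every admissible contour system (the contour of a weighted pair `(y,z)`
ends at `z`) and every `φ`: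
`|(4.8) at A₀| ≤ K·(ε₁ + ε₂)·|U(κA₀(x → x′))φ(x′) − φ(x)|·(|φ(x)| + |φ(x′)|)`, with the transporter of `A₀` from the
block site `emb x` to `emb x′` (= `U(A₀(⟨x,x′⟩))` along any contour, `B4Ineq410GaugeOut.transport_constBond`).
[cite: Balaban1983RegularityDecay, (4.10) p.591 with p.590] -/
theorem ineq410_first_constBond (d : ℕ) (q : Matrix ι ι ℝ) (hq : qᵀ = -q) (aminus aplus m2plus : ℝ)
    (ha : 0 < aminus) :
    ∃ K : ℝ, 0 ≤ K ∧ ∀ (n : ℕ) (hn : 1 ≤ n) (a m2 : ℝ), aminus ≤ a → a ≤ aplus → 0 ≤ m2 → m2 ≤ m2plus →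
      ∀ (μ : Fin (d + 1)) (κ : ℝ) (emb : ↥(boxDom (twoBlk μ)) → ↥(boxDom (fun i => n * twoBlk μ i)))
        (Γ : ↥(boxDom (twoBlk μ)) → ↥(boxDom (fun i => n * twoBlk μ i)) → List ↥(boxDom (fun i => n * twoBlk μ i))),
        (∀ y x, blkWt n (twoBlk μ) (fun i => n * twoBlk μ i) y x ≠ 0 → pathEnd (emb y) (Γ y x) = x) →
        ∀ (A₀ : Fin (d + 1) → ℝ)
        (A' : ↥(boxDom (fun i => n * twoBlk μ i)) → ↥(boxDom (fun i => n * twoBlk μ i)) → ℝ) (ε₁ ε₂ : ℝ),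
        0 ≤ ε₁ → 0 ≤ ε₂ →
        (∀ x y : ↥(boxDom (fun i => n * twoBlk μ i)), y.1 ∈ nbrs x.1 → (n : ℝ) * |κ * A' x y| ≤ ε₁) →
        (∀ (y : ↥(boxDom (twoBlk μ))) (x : ↥(boxDom (fun i => n * twoBlk μ i))), blk n x.1 = y.1 →
          |κ * lsum A' (emb y) (Γ y x)| ≤ ε₂) →
        ∀ Ψ : ↥(boxDom (twoBlk μ)) × ι → ℝ,
          |firstOrder48Box q hq κ n a m2 μ emb Γ (constBond A₀ Subtype.val) A' Ψ|
            ≤ K * (ε₁ + ε₂)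
                * siteNorm ((expFlow q hq).U (κ * constBond A₀ Subtype.val (emb (siteX μ)) (emb (siteX' μ)))
                    *ᵥ fld Ψ (siteX' μ) - fld Ψ (siteX μ))
                * (siteNorm (fld Ψ (siteX μ)) + siteNorm (fld Ψ (siteX' μ))) := by
  obtain ⟨K, hK, h⟩ := ineq410_first_zero d q hq aminus aplus m2plus ha
  refine ⟨K, hK, ?_⟩
  intro n hn a m2 h1 h2 h3 h4 μ κ emb Γ hend A₀ A' ε₁ ε₂ hε₁ hε₂ hA1 hA2 Ψ
  have ha' : 0 < a := lt_of_lt_of_le ha h1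
  have hend' : ∀ y x, outWtB n μ y x ≠ 0 → pathEnd (emb y) (Γ y x) = x := by
    intro y x hne
    refine hend y x fun h0 => hne ?_
    simp only [outWtB, h0, mul_zero]
  have hgauge := firstOrder48_constBond q hq κ (boxWt n (fun i => n * twoBlk μ i)) m2 (a * ((n : ℝ) ^ (d + 1))⁻¹)
    hend hend' (scalarOp_box_isUnit hn ha' h3 μ) a A₀ Subtype.val (siteX μ) A' Ψ
  have h0 := h n hn a m2 h1 h2 h3 h4 μ κ emb Γ A' ε₁ ε₂ hε₁ hε₂ hA1 hA2
    (gaugeOut (expFlow q hq) κ emb A₀ Subtype.val (siteX μ) Ψ)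
  rw [gaugeOut_fld_base, gaugeOut_fld, siteNorm_mulVec_of_orth ((expFlow q hq).orth _)] at h0
  rw [firstOrder48Box, hgauge]
  exact h0

/-- **(4.10) ⇒ (4.11) ON THE MODEL, MODULO THE SECOND-ORDER REMAINDER**: r01's bookkeeping `B4Ineq410GaugeOut.ineq411`
with its first-order hypothesis `hF` DISCHARGED by `ineq410_first_constBond` + `delta_split` — given the printed
decomposition `LHS(4.7)(A₀ + A′) = LHS(4.7)(A₀) + (4.8) + R` with «the remaining terms … estimated by O(e²p²(e))(|φ(x)|²
+ |φ(x′)|²)» («Using Lemma 2.1», imported from [2]; the hypothesis `hR`), for every `δ > 0`: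
`LHS(4.7)(A₀) − δ|U(A₀(⟨x,x′⟩))φ(x′) − φ(x)|² − (K²/(2δ) + K_R)(ε₁+ε₂)²(|φ(x)|² + |φ(x′)|²) ≤ LHS(4.7)(A₀ + A′)`.
[cite: Balaban1983RegularityDecay, (4.11) p.591] -/
theorem ineq411_box (d : ℕ) (q : Matrix ι ι ℝ) (hq : qᵀ = -q) (aminus aplus m2plus : ℝ) (ha : 0 < aminus) :
    ∃ K : ℝ, 0 ≤ K ∧ ∀ (n : ℕ) (hn : 1 ≤ n) (a m2 : ℝ), aminus ≤ a → a ≤ aplus → 0 ≤ m2 → m2 ≤ m2plus →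
      ∀ (μ : Fin (d + 1)) (κ : ℝ) (emb : ↥(boxDom (twoBlk μ)) → ↥(boxDom (fun i => n * twoBlk μ i)))
        (Γ : ↥(boxDom (twoBlk μ)) → ↥(boxDom (fun i => n * twoBlk μ i)) → List ↥(boxDom (fun i => n * twoBlk μ i))),
        (∀ y x, blkWt n (twoBlk μ) (fun i => n * twoBlk μ i) y x ≠ 0 → pathEnd (emb y) (Γ y x) = x) →
        ∀ (A₀ : Fin (d + 1) → ℝ)
        (A' : ↥(boxDom (fun i => n * twoBlk μ i)) → ↥(boxDom (fun i => n * twoBlk μ i)) → ℝ) (ε₁ ε₂ : ℝ),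
        0 ≤ ε₁ → 0 ≤ ε₂ →
        (∀ x y : ↥(boxDom (fun i => n * twoBlk μ i)), y.1 ∈ nbrs x.1 → (n : ℝ) * |κ * A' x y| ≤ ε₁) →
        (∀ (y : ↥(boxDom (twoBlk μ))) (x : ↥(boxDom (fun i => n * twoBlk μ i))), blk n x.1 = y.1 →
          |κ * lsum A' (emb y) (Γ y x)| ≤ ε₂) →
        ∀ (Ψ : ↥(boxDom (twoBlk μ)) × ι → ℝ) (L R K_R δ : ℝ), 0 < δ →
          L = lhs47Box (expFlow q hq) κ n a m2 μ emb Γ (constBond A₀ Subtype.val) Ψ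
                + firstOrder48Box q hq κ n a m2 μ emb Γ (constBond A₀ Subtype.val) A' Ψ + R →
          |R| ≤ K_R * (ε₁ + ε₂) ^ 2 * (siteNorm (fld Ψ (siteX μ)) ^ 2 + siteNorm (fld Ψ (siteX' μ)) ^ 2) →
          lhs47Box (expFlow q hq) κ n a m2 μ emb Γ (constBond A₀ Subtype.val) Ψ
              - δ * siteNorm ((expFlow q hq).U (κ * constBond A₀ Subtype.val (emb (siteX μ)) (emb (siteX' μ)))
                    *ᵥ fld Ψ (siteX' μ) - fld Ψ (siteX μ)) ^ 2
              - (K ^ 2 / (2 * δ) + K_R) * (ε₁ + ε₂) ^ 2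
                  * (siteNorm (fld Ψ (siteX μ)) ^ 2 + siteNorm (fld Ψ (siteX' μ)) ^ 2) ≤ L := by
  obtain ⟨K, hK, h⟩ := ineq410_first_constBond d q hq aminus aplus m2plus ha
  refine ⟨K, hK, ?_⟩
  intro n hn a m2 h1 h2 h3 h4 μ κ emb Γ hend A₀ A' ε₁ ε₂ hε₁ hε₂ hA1 hA2 Ψ L R K_R δ hδ hdec hR
  have hF := (h n hn a m2 h1 h2 h3 h4 μ κ emb Γ hend A₀ A' ε₁ ε₂ hε₁ hε₂ hA1 hA2 Ψ).trans
    (delta_split K (ε₁ + ε₂) _ _ _ hδ)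
  exact B4Ineq410GaugeOut.ineq411 hdec hF hR

end Main


end

end Literature.MathematicalPhysics.QuantumFieldTheory.Balaban1983to89.B4Ineq410FirstOrder
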